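import Literature.MathematicalPhysics.QuantumFieldTheory.Balaban1983to89.B8LambdaSpaceKLevel
import Literature.MathematicalPhysics.QuantumFieldTheory.Balaban1983to89.B8Prop5LocalLipschitz

/-!
# `Balaban1983to89.B8Prop5ContractionKLevel` — T. Bałaban, *Spaces of regular gauge field configurations on a lattice and gauge fixing
# conditions*, Commun. Math. Phys. **99** (1985) 75–102 [Balaban1985RegularSpaces] ("B8"), Sect. D pp. 92–94: THE CONTRACTION OF
# PROPOSITION 5 AT `k` LEVELS ON THE CONCRETE `ℤᵈ × 𝔸` CARRIERS — the Neumann inversion (1.96) of `I + RVR`, the size (1.99) of the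
# nonlinearity `R𝔉₄` and its Lipschitz modulus (1.106), and the fixed point of (1.100) in the domain (1.102) (`B8LambdaSpaceKLevel.lamSubK`),
# MODULO the letters `G′`, `R` of [4] and a displayed gauge-parameter map `λ ↦ λ′` (Sect. E's `λ − H′D′(u₁, λ)`, possibly `Ad(u₁⁻¹)`-conjugated)

statement-level skeleton of published theorems with citation tags; proofs where landed; nothing here is a claim about the
Yang–Mills mass gap

PDF held: `paper:balaban1985-cmp99-regular-spaces-gauge-fixing` (journal page = PDF page + 74); pp. 91–95 [PDF 17–21] read on the text
layer by this seat (2026-08-26).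

WHAT IS PRINTED (pp. 92–94, verbatim where legible).  p. 92: *"The operator in (1.94) acting on Δλ is equal to I + RVR and its inverse is
given by the Neumann series (I + RVR)⁻¹ = I + Σ_{n≥1}(−1)ⁿ(RVR)ⁿ = I + Σ_{n≥1}(−1)ⁿR(VR)ⁿ. (1.96) … |Rf|₍₋₂₎ ≤ B′₀|f|₍₋₂₎, |Vf|₍₋₂₎ ≤
O(α₄)|f|₍₋₂₎. (1.98)"*; p. 93: *"|R𝔉₄(λ, Dλ, A, D\*A)| ≤ C′₄B₁(α₀+α₁)α₄(Lʲη)⁻² on Ω_j (1.99) … λ = G′RD\*A + G′R𝔉₄(λ, Dλ, A, D\*A). (1.100)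
… |𝔉(λ)|, |D𝔉(λ)|₍₋₁₎ ≤ B′₀B₁(α₀+α₁) + B′₀C′₄B₁(α₀+α₁)α₄ … (1.101) if λ belongs to the space {λ : |λ|, |Dλ|₍₋₁₎ < βα₄}. (1.102) …
(1.103)"*; p. 94: *"(1.104) … (1.105) … (1.106) … Thus the transformation 𝔉 maps the domain (1.102) with β = ¼ into itself and is
contractive … The contraction mapping theorem implies that there exists a unique fixed point of this transformation in the considered
domain."*; p. 91 (1.88): *"(D\*(1/iη) log U₁^{u′⁻¹})(x) = e^{−i ad_{λ(x)}}(D\*A)(x) + g(i ad_{λ(x)})(D\*Dλ)(x) + 𝔉₃(λ(x), Dλ, A)"*.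

WHY THIS FILE (cell `pub-ymgap`, HUMAN RULING D-0062, dag-lead REBALANCE №41-b; seat `pub-ymgap-dag-n19-b` g2; CUT-3 of `pub-ymgap-dag-n05-a`,
route step (i)).  With the domain (1.102) a Banach space (`B8LambdaSpaceKLevel`, p421901) and the local sizes / Lipschitz moduli of the
(1.82)–(1.89) functions (`B8Prop5LocalLipschitz`, p424878), this file runs Sect. D's contraction for the NONLINEARITY OF (1.88):  writing the
gauge parameter of (1.88) as `a = λ′` (a displayed map of the unknown `λ`; Sect. E's `λ − H′D′(u₁, λ)`, conjugated by `Ad(u₁⁻¹)` under the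
owner's ORDER ruling (a), INBOX l.11042) and `Δλ′ = Δλ + E(λ)` (the displayed linearisation defect), (1.88) reads
`D\*A′ = Δλ + V_λ(Δλ) + W_λ`, `V_λ = g(i ad_{λ′}) − 1` (sitewise, print's V), `W_λ = e^{−i ad_{λ′}}(D\*A) + g(i ad_{λ′})E(λ) + Σ_μ 𝔉₃,μ(λ′, A)`;
(1.95)/(1.100) become `λ = G′R(−Z_λ)` with `Z_λ` THE solution of `Z + V_λ(RZ) = W_λ` — the Neumann inversion (1.96) of `I + V_λR`, done here by a
second contraction (no series; see `pub-ymgap-dag-n04-b`'s use in REBALANCE №41-a: at the fixed point `Δλ + VΔλ + W = Z − RZ`, so `R(D\*A′) = 0`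
by `R² = R`, `B8Eq195Linear`).  Proposition 5's socket `hP5` of the Theorem-4 knit (`B8Thm4SupportLocal.thm4_exists_all_levels_supp_landau138`) is
then read off by `pub-ymgap-dag-n04-b` (`B8Prop5KLevelLetters`, steps (ii)–(iii)); the instantiation of the displayed maps `gpar` / `Eterm` by
Sect. E's `D′` (`pub-ymgap-dag-n05-b`: `B8SectEKLevelDomainSeq.exists_Dprime_kLevel_of_domainSeq`, `B8DprimeKLevelLipschitz.Dprime_lipschitz_kLevel`) and
the conjugation price (`B8Prop5KLevelLetters.covDerivFwd_conj_param`, `norm_covDerivFwd_gaugeAct_sub_le`) is a corollary file (v1.1), not here.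

WHAT IS TYPED / PROVED HERE (0 sorry; definitions with bodies + kernel-checked theorems).
* §1 `Bd2 L η k Ω f m` — the pointwise form of print's `|f|₍₋₂₎ ≤ m` («(Lʲη)²|f| ≤ m on Ω_j, j ≤ k»), with its additive API.
* §2 THE NEUMANN INVERSION (1.96) WITHOUT SERIES: `Zseq W V R` (Picard iterates `Z₀ = W`, `Z_{n+1} = W − V(RZ_n)`), `Zsol W V R` (their pointwise
  limit); for a sitewise-linear `V` with `|Vf| ≤ c_V|f|` on the `Ω_j` ((1.98)V), an additive letter `R` with `|Rf|₍₋₂₎ ≤ B_R|f|₍₋₂₎` ((1.98)R) and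
  `c_VB_R ≤ ½` (p. 92 «O(α₄)B′₀² ≤ ½»): `bd2_zseq_sub` (geometric differences), `bd2_zseq`, `tendsto_zsol`, `bd2_zseq_sub_zsol`, **`bd2_zsol`**
  (`|Z|₍₋₂₎ ≤ 2|W|₍₋₂₎`), **`zsol_eq`** (`Z + V(RZ) = W` on every `Ω_j`), **`bd2_zsol_sub_zsol`** (Lipschitz dependence of `Z` on the data `(W, V)`,
  by the resolvent recursion).
* §3 THE CONCRETE `V`, `W` OF (1.88)/(1.94): `Vop a f x = g(i ad_{a(x)})f(x) − f(x)`, `Wsrc η U₀ A DA a E x = e^{−i ad_{a(x)}}(DA x) + g(i ad_{a(x)})E(x) +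
  Σ_μ 𝔉₃,μ(a, A)(x)` in the tree's (1.88) vocabulary (`B8Eq182Proof.gAd`, `B8Eq184Proof.gaugeExp`, `B8Eq188Proof.frakF3`); `Vop_sub` (with `B8Prop5KLevelLetters.gAd_sub`'s content inlined), **`norm_Vop_le`**
  (print's «|V| ≤ O(α₄)»: `≤ 10a₁|f|`), **`norm_Vop_sub_Vop_le`**, **`wt_sq_norm_Wsrc_le`** (the size of `W`: `(Lʲη)²|W| ≤ (6/5)c_{DA} + 2m_E + d(82b₁² + 34c_Ab₁)`
  from the displayed sizes of `a`, `Da`, `E`, `D\*A`, `A` — (1.89) by name), **`wt_sq_norm_Wsrc_sub_le`** (its Lipschitz modulus in `(a, E)` — the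
  (1.104)–(1.106) content, from `B8Prop5LocalLipschitz`).
* §4 **`propFive_fixedPoint_kLevel`** — THE FIXED POINT OF (1.100) AT `k` LEVELS: for the letters `Gp` (G′, (1.101)-shape bound `hG`, additive) and `R`
  ((1.98)R, additive), displayed maps `gpar` (λ ↦ λ′: sizes `a₁`, `b₁` of `λ′`, `Dλ′` and moduli `ℓ₀`, `ℓ₁` on the ¼α₄-ball) and `Eterm` (λ ↦ Δλ′ − Δλ:
  size `m_E`, modulus `K_E`), the datum `DA = D\*A`, `A` ((1.69)-type sizes `c_{DA}`, `c_A`), under the windows `a₁ ≤ 1/24`, `0 < b₁ ≤ 1/140`, `c_A ≤ 1/13`,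
  `10a₁B_R ≤ ½` and the two smallness conditions (1.103)/(1.106) in the explicit constants `M`, `K` of this file: **there is exactly one `s` in the
  closed ¼α₄-ball of `lamSubK η U₀ L k Eb` with `λ_s = G′(R(−Z_{λ_s}))`**; `propFive_fixedPoint_kLevel_spec`: at it, the Neumann identity
  `Z + V(RZ) = W` on every `Ω_j`, the bound `‖s‖ ≤ B_G·M` ((1.108)'s source), and `λ_s = 0` off `Ω₀` when `G′` has the Dirichlet range (owner's addition,
  INBOX l.10982).

READINGS / HONEST SCOPE.  (i) The letters `G′`, `R` ([4] (3.24)–(3.25), Thms 3.1–3.2: in-edge b9), the maps `gpar`/`Eterm` (Sect. E's `D′` + the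
ORDER conjugation) and the datum's (1.69) sizes are DISPLAYED HYPOTHESES; their algebraic laws (`Q′G′R = 0`, `R² = R`, …) are not used here (they
are №41-a's).  (ii) Constants are ours and merely sufficient; the final smallness is left as the two hypotheses `h103`/`h106` on the explicit `M`, `K`
(print: (1.103) with β = ¼ and «½C′₄α₄ ≤ ½»), to be scheduled by the pin with `α₄ = 8B′₀B₁(α₀+α₁)`.  (iii) Reality of the fixed point (`u′` unitary)
is offered through `B8LambdaSpaceKLevel.fixedPoint_kLevel_selfAdjoint` under a displayed invariance hypothesis — the self-adjointness of `W`/`V`/`Z` on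
real data is NOT proved here (v1.1).  (iv) Nothing of Proposition 5's conclusion (1.107) is asserted: that is №41-a's step (ii).  Count-neutral; N05
NOT discharged; nothing continuum / ℝ⁴ / OS / mass-gap / Clay.  Unit `pub-ymgap-dag-n19-b` (g2), 2026-08-26.  Tree API by name only, nothing restated.
-/

noncomputable section

open NormedSpace Metric Set Filter Topology
open Complex (I)

namespace Literature.MathematicalPhysics.QuantumFieldTheory.Balaban1983to89.B8Prop5ContractionKLevel

open B7Prop1Explicit (e expUnit)
open B7Eq78Linearization (conjR conjR_apply conjR_add conjR_sub conjR_smul)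
open B8Ineq132 (covDerivFwd covDeriv)
open B8Eq182Proof (gAd frakF1 frakF2)
open B8Eq184Proof (gaugeExp)
open B8Eq188Proof (frakF3 norm_frakF3_le gAd_add gAd_neg)
open B8LambdaSpaceKLevel (wt wt_pos wt_nonneg lamSubK lamOf lamOf_sub norm_le_iff norm_sub_le_iff fixedPoint_kLevel
  norm_fixedPoint_kLevel_le covDerivFwd_sub')
open B8Prop5LocalLipschitz (norm_gAd_sub_self_le_mul norm_gAd_sub_gAd_le norm_gAd_le' norm_conjExp_le norm_conjExp_sub_conjExp_le
  conjR_expUnit_inv_eq norm_frakF1_sub_le norm_frakF2_sub_le rexp_one_sixth_le)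
open B7Eq38Remainder (norm_I_smul')

-- `Site` alone could resolve to the torus sites of `Setup.lean`; re-export the `ℤ^d` sites of `B7Prop1Explicit`.
export B7Prop1Explicit (Site)

variable {d : ℕ} {𝔸 : Type*} [NormedRing 𝔸] [NormOneClass 𝔸] [NormedAlgebra ℂ 𝔸] [CompleteSpace 𝔸]

/-! ## §1 The pointwise form of `|f|₍₋₂₎ ≤ m` on the `Ω_j`, `j ≤ k` -/

section Bd

omit [NormOneClass 𝔸] [NormedAlgebra ℂ 𝔸] [CompleteSpace 𝔸] in
/-- **`|f|₍₋₂₎ ≤ m` in pointwise form**: `(Lʲη)²‖f(x)‖ ≤ m` for every `x ∈ Ω_j`, `j ≤ k` (p. 86: `|f|₍₋₂₎ = sup_j sup_{Ω_j}(Lʲη)²|f|`).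
[cite: Balaban1985RegularSpaces, p.86 (after (1.55)), (1.98) p.92] -/
def Bd2 (L : ℕ) (η : ℝ) (k : ℕ) (Ω : ℕ → Set (Site d)) (f : Site d → 𝔸) (m : ℝ) : Prop :=
  ∀ j, j ≤ k → ∀ x ∈ Ω j, wt L η j ^ 2 * ‖f x‖ ≤ m

variable {L k : ℕ} {η : ℝ} {Ω : ℕ → Set (Site d)}

omit [NormOneClass 𝔸] [NormedAlgebra ℂ 𝔸] [CompleteSpace 𝔸] in
/-- Monotonicity in the bound. [cite: Balaban1985RegularSpaces, (1.98) p.92] -/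
theorem Bd2.mono {f : Site d → 𝔸} {m m' : ℝ} (h : Bd2 L η k Ω f m) (hm : m ≤ m') : Bd2 L η k Ω f m' :=
  fun j hj x hx => (h j hj x hx).trans hm

omit [NormOneClass 𝔸] [NormedAlgebra ℂ 𝔸] [CompleteSpace 𝔸] in
/-- `|f + g|₍₋₂₎ ≤ |f|₍₋₂₎ + |g|₍₋₂₎`. [cite: Balaban1985RegularSpaces, (1.98) p.92] -/
theorem Bd2.add {f g : Site d → 𝔸} {m m' : ℝ} (hf : Bd2 L η k Ω f m) (hg : Bd2 L η k Ω g m') :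
    Bd2 L η k Ω (f + g) (m + m') := by
  intro j hj x hx
  have h1 := hf j hj x hx; have h2 := hg j hj x hx
  have hw : 0 ≤ wt L η j ^ 2 := sq_nonneg _
  calc wt L η j ^ 2 * ‖(f + g) x‖ ≤ wt L η j ^ 2 * (‖f x‖ + ‖g x‖) := by
        rw [Pi.add_apply]; exact mul_le_mul_of_nonneg_left (norm_add_le _ _) hw
    _ ≤ m + m' := by rw [mul_add]; exact add_le_add h1 h2

omit [NormOneClass 𝔸] [NormedAlgebra ℂ 𝔸] [CompleteSpace 𝔸] in
/-- `|−f|₍₋₂₎ = |f|₍₋₂₎`. [cite: Balaban1985RegularSpaces, (1.98) p.92] -/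
theorem Bd2.neg {f : Site d → 𝔸} {m : ℝ} (hf : Bd2 L η k Ω f m) : Bd2 L η k Ω (-f) m := by
  intro j hj x hx; rw [Pi.neg_apply, norm_neg]; exact hf j hj x hx

omit [NormOneClass 𝔸] [NormedAlgebra ℂ 𝔸] [CompleteSpace 𝔸] in
/-- `|f − g|₍₋₂₎ ≤ |f|₍₋₂₎ + |g|₍₋₂₎`. [cite: Balaban1985RegularSpaces, (1.98) p.92] -/
theorem Bd2.sub {f g : Site d → 𝔸} {m m' : ℝ} (hf : Bd2 L η k Ω f m) (hg : Bd2 L η k Ω g m') :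
    Bd2 L η k Ω (f - g) (m + m') := by
  rw [sub_eq_add_neg]; exact hf.add hg.neg

omit [NormOneClass 𝔸] [NormedAlgebra ℂ 𝔸] [CompleteSpace 𝔸] in
/-- A nonnegative bound bounds `0`. [cite: Balaban1985RegularSpaces, (1.98) p.92] -/
theorem bd2_zero {m : ℝ} (hm : 0 ≤ m) : Bd2 L η k Ω (0 : Site d → 𝔸) m := by
  intro j hj x hx; simp [hm]

omit [NormOneClass 𝔸] [NormedAlgebra ℂ 𝔸] [CompleteSpace 𝔸] in
/-- A bound is nonnegative as soon as some `Ω_j`, `j ≤ k`, is inhabited; in general `Bd2 f m → Bd2 f (max m 0)`.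
[cite: Balaban1985RegularSpaces, (1.98) p.92] -/
theorem Bd2.max_zero {f : Site d → 𝔸} {m : ℝ} (hf : Bd2 L η k Ω f m) : Bd2 L η k Ω f (max m 0) :=
  hf.mono (le_max_left _ _)

omit [NormOneClass 𝔸] [NormedAlgebra ℂ 𝔸] [CompleteSpace 𝔸] in
/-- Pointwise reading of a bound at a site: `‖f x‖ ≤ m·(Lʲη)⁻²` (`L ≥ 1`, `η > 0`). [cite: Balaban1985RegularSpaces, (1.99) p.93] -/
theorem Bd2.norm_le (hL : 1 ≤ L) (hη : 0 < η) {f : Site d → 𝔸} {m : ℝ} (hf : Bd2 L η k Ω f m) {j : ℕ} (hj : j ≤ k)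
    {x : Site d} (hx : x ∈ Ω j) : ‖f x‖ ≤ m * (wt L η j ^ 2)⁻¹ := by
  have hw : 0 < wt L η j ^ 2 := pow_pos (wt_pos hL hη j) 2
  rw [le_mul_inv_iff₀ hw, mul_comm]; exact hf j hj x hx

end Bd

/-! ## §2 The Neumann inversion (1.96) of `I + VR` by a contraction: `Z + V(RZ) = W` -/

section Neumann

variable {L k : ℕ} {η : ℝ} {Ω : ℕ → Set (Site d)}

/-- The Picard iterates of `Z ↦ W − V(RZ)`: `Z₀ = W`, `Z_{n+1} = W − V(RZ_n)` (the partial sums of (1.96) applied to `W`, regrouped).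
[cite: Balaban1985RegularSpaces, (1.96) p.92] -/
def Zseq (W : Site d → 𝔸) (V R : (Site d → 𝔸) → (Site d → 𝔸)) : ℕ → (Site d → 𝔸)
  | 0 => W
  | n + 1 => fun x => W x - V (R (Zseq W V R n)) x

/-- **`Z = (I + VR)⁻¹W`** as the pointwise limit of the Picard iterates (on the `Ω_j` it converges geometrically; elsewhere the value is
irrelevant). [cite: Balaban1985RegularSpaces, (1.96) p.92] -/
def Zsol (W : Site d → 𝔸) (V R : (Site d → 𝔸) → (Site d → 𝔸)) : Site d → 𝔸 :=
  fun x => limUnder atTop (fun n => Zseq W V R n x)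

omit [NormOneClass 𝔸] [NormedAlgebra ℂ 𝔸] [CompleteSpace 𝔸] in
/-- The recursion, unfolded. [cite: Balaban1985RegularSpaces, (1.96) p.92] -/
theorem zseq_succ (W : Site d → 𝔸) (V R : (Site d → 𝔸) → (Site d → 𝔸)) (n : ℕ) (x : Site d) :
    Zseq W V R (n + 1) x = W x - V (R (Zseq W V R n)) x := rfl

omit [NormOneClass 𝔸] [NormedAlgebra ℂ 𝔸] [CompleteSpace 𝔸] in
/-- `Z₀ = W`. [cite: Balaban1985RegularSpaces, (1.96) p.92] -/
theorem zseq_zero (W : Site d → 𝔸) (V R : (Site d → 𝔸) → (Site d → 𝔸)) : Zseq W V R 0 = W := rfl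

variable {W : Site d → 𝔸} {V R : (Site d → 𝔸) → (Site d → 𝔸)} {cV BR mW : ℝ}

omit [NormOneClass 𝔸] [NormedAlgebra ℂ 𝔸] [CompleteSpace 𝔸] in
/-- **The differences of the iterates are geometric**: `|Z_{n+1} − Z_n|₍₋₂₎ ≤ (c_VB_R)^{n+1}|W|₍₋₂₎` — (1.98): each application of `VR` costs the
factor `c_VB_R` (`V` sitewise-linear with `|Vf| ≤ c_V|f|`, `R` additive with `|Rf|₍₋₂₎ ≤ B_R|f|₍₋₂₎`).
[cite: Balaban1985RegularSpaces, (1.96), (1.98) p.92] -/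
theorem bd2_zseq_sub (hVsub : ∀ f g : Site d → 𝔸, ∀ j, j ≤ k → ∀ x ∈ Ω j, V f x - V g x = V (f - g) x)
    (hVbd : ∀ f : Site d → 𝔸, ∀ j, j ≤ k → ∀ x ∈ Ω j, ‖V f x‖ ≤ cV * ‖f x‖)
    (hRsub : ∀ f g : Site d → 𝔸, R (f - g) = R f - R g)
    (hRbd : ∀ (f : Site d → 𝔸) (m : ℝ), 0 ≤ m → Bd2 L η k Ω f m → Bd2 L η k Ω (R f) (BR * m))
    (hW : Bd2 L η k Ω W mW) (hcV : 0 ≤ cV) (hBR : 0 ≤ BR) (hmW : 0 ≤ mW) :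
    ∀ n, Bd2 L η k Ω (Zseq W V R (n + 1) - Zseq W V R n) ((cV * BR) ^ (n + 1) * mW) := by
  -- the key step: `|V(Rg)|₍₋₂₎ ≤ c_VB_R|g|₍₋₂₎`
  have step : ∀ (g : Site d → 𝔸) (m : ℝ), 0 ≤ m → Bd2 L η k Ω g m →
      Bd2 L η k Ω (fun x => V (R g) x) (cV * BR * m) := by
    intro g m hm hg j hj x hx
    have hR := hRbd g m hm hg j hj x hx
    have hw : 0 ≤ wt L η j ^ 2 := sq_nonneg _
    calc wt L η j ^ 2 * ‖V (R g) x‖ ≤ wt L η j ^ 2 * (cV * ‖R g x‖) := mul_le_mul_of_nonneg_left (hVbd _ j hj x hx) hw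
      _ = cV * (wt L η j ^ 2 * ‖R g x‖) := by ring
      _ ≤ cV * (BR * m) := mul_le_mul_of_nonneg_left hR hcV
      _ = cV * BR * m := by ring
  intro n
  induction n with
  | zero =>
    intro j hj x hx
    have h := step W mW hmW hW j hj x hx
    have heq : (Zseq W V R (0 + 1) - Zseq W V R 0) x = -(V (R W) x) := by
      simp only [Pi.sub_apply, zseq_succ, zseq_zero]; abel
    rw [heq, norm_neg, zero_add, pow_one]; exact h
  | succ n ih =>
    intro j hj x hx
    have hm : 0 ≤ (cV * BR) ^ (n + 1) * mW := by positivity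
    have h := step _ _ hm ih j hj x hx
    have heq : (Zseq W V R (n + 1 + 1) - Zseq W V R (n + 1)) x =
        -(V (R (Zseq W V R (n + 1) - Zseq W V R n)) x) := by
      simp only [Pi.sub_apply, zseq_succ]
      rw [hRsub, ← hVsub _ _ j hj x hx]; abel
    rw [heq, norm_neg]
    calc wt L η j ^ 2 * ‖V (R (Zseq W V R (n + 1) - Zseq W V R n)) x‖ ≤ cV * BR * ((cV * BR) ^ (n + 1) * mW) := h
      _ = (cV * BR) ^ (n + 1 + 1) * mW := by ring

omit [NormOneClass 𝔸] [NormedAlgebra ℂ 𝔸] [CompleteSpace 𝔸] in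
/-- **The iterates stay bounded**: `|Z_n|₍₋₂₎ ≤ (2 − (c_VB_R)ⁿ)|W|₍₋₂₎ ≤ 2|W|₍₋₂₎` when `c_VB_R ≤ ½` (p. 92: «O(α₄)B′₀² ≤ ½»).
[cite: Balaban1985RegularSpaces, (1.96)–(1.98) p.92] -/
theorem bd2_zseq (hVsub : ∀ f g : Site d → 𝔸, ∀ j, j ≤ k → ∀ x ∈ Ω j, V f x - V g x = V (f - g) x)
    (hVbd : ∀ f : Site d → 𝔸, ∀ j, j ≤ k → ∀ x ∈ Ω j, ‖V f x‖ ≤ cV * ‖f x‖)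
    (hRsub : ∀ f g : Site d → 𝔸, R (f - g) = R f - R g)
    (hRbd : ∀ (f : Site d → 𝔸) (m : ℝ), 0 ≤ m → Bd2 L η k Ω f m → Bd2 L η k Ω (R f) (BR * m))
    (hW : Bd2 L η k Ω W mW) (hcV : 0 ≤ cV) (hBR : 0 ≤ BR) (hmW : 0 ≤ mW) (hθ : cV * BR ≤ 1 / 2) :
    ∀ n, Bd2 L η k Ω (Zseq W V R n) (2 * mW) := by
  have hθ0 : 0 ≤ cV * BR := by positivity
  have main : ∀ n, Bd2 L η k Ω (Zseq W V R n) ((2 - (cV * BR) ^ n) * mW) := by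
    intro n
    induction n with
    | zero => rw [zseq_zero, pow_zero, show ((2 : ℝ) - 1) * mW = mW by ring]; exact hW
    | succ n ih =>
      have hd := bd2_zseq_sub hVsub hVbd hRsub hRbd hW hcV hBR hmW n
      have hsum := ih.add hd
      have heq : Zseq W V R n + (Zseq W V R (n + 1) - Zseq W V R n) = Zseq W V R (n + 1) := by abel
      rw [heq] at hsum
      refine hsum.mono ?_
      have hpow : (cV * BR) ^ (n + 1) ≤ (cV * BR) ^ n * (1 / 2) := by
        rw [pow_succ]; exact mul_le_mul_of_nonneg_left hθ (pow_nonneg hθ0 n)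
      nlinarith [pow_nonneg hθ0 n, pow_nonneg hθ0 (n + 1)]
  intro n
  refine (main n).mono ?_
  nlinarith [pow_nonneg hθ0 n]

variable (hL : 1 ≤ L) (hη : 0 < η)
include hL hη

omit [NormOneClass 𝔸] [NormedAlgebra ℂ 𝔸] in
/-- **The iterates converge on every `Ω_j`** (geometric Cauchy sequence in the complete algebra) **to `Zsol`**.
[cite: Balaban1985RegularSpaces, (1.96) p.92] -/
theorem tendsto_zsol (hVsub : ∀ f g : Site d → 𝔸, ∀ j, j ≤ k → ∀ x ∈ Ω j, V f x - V g x = V (f - g) x)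
    (hVbd : ∀ f : Site d → 𝔸, ∀ j, j ≤ k → ∀ x ∈ Ω j, ‖V f x‖ ≤ cV * ‖f x‖)
    (hRsub : ∀ f g : Site d → 𝔸, R (f - g) = R f - R g)
    (hRbd : ∀ (f : Site d → 𝔸) (m : ℝ), 0 ≤ m → Bd2 L η k Ω f m → Bd2 L η k Ω (R f) (BR * m))
    (hW : Bd2 L η k Ω W mW) (hcV : 0 ≤ cV) (hBR : 0 ≤ BR) (hmW : 0 ≤ mW) (hθ : cV * BR ≤ 1 / 2)
    {j : ℕ} (hj : j ≤ k) {x : Site d} (hx : x ∈ Ω j) :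
    Tendsto (fun n => Zseq W V R n x) atTop (𝓝 (Zsol W V R x)) := by
  have hw : 0 < wt L η j ^ 2 := pow_pos (wt_pos hL hη j) 2
  have hdist : ∀ n, dist (Zseq W V R n x) (Zseq W V R (n + 1) x) ≤ (cV * BR * mW * (wt L η j ^ 2)⁻¹) * (cV * BR) ^ n := by
    intro n
    have h := (bd2_zseq_sub hVsub hVbd hRsub hRbd hW hcV hBR hmW n).norm_le hL hη hj hx
    rw [dist_eq_norm, ← norm_neg, neg_sub, ← Pi.sub_apply]
    calc ‖(Zseq W V R (n + 1) - Zseq W V R n) x‖ ≤ (cV * BR) ^ (n + 1) * mW * (wt L η j ^ 2)⁻¹ := h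
      _ = (cV * BR * mW * (wt L η j ^ 2)⁻¹) * (cV * BR) ^ n := by ring
  have hcau : CauchySeq (fun n => Zseq W V R n x) :=
    cauchySeq_of_le_geometric (cV * BR) _ (by linarith) hdist
  exact tendsto_nhds_limUnder (cauchySeq_tendsto_of_complete hcau)

omit [NormOneClass 𝔸] [NormedAlgebra ℂ 𝔸] in
/-- **Geometric tail**: `|Z_n − Z|₍₋₂₎ ≤ (c_VB_R)ⁿ|W|₍₋₂₎` (`c_VB_R ≤ ½`). [cite: Balaban1985RegularSpaces, (1.96) p.92] -/
theorem bd2_zseq_sub_zsol (hVsub : ∀ f g : Site d → 𝔸, ∀ j, j ≤ k → ∀ x ∈ Ω j, V f x - V g x = V (f - g) x)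
    (hVbd : ∀ f : Site d → 𝔸, ∀ j, j ≤ k → ∀ x ∈ Ω j, ‖V f x‖ ≤ cV * ‖f x‖)
    (hRsub : ∀ f g : Site d → 𝔸, R (f - g) = R f - R g)
    (hRbd : ∀ (f : Site d → 𝔸) (m : ℝ), 0 ≤ m → Bd2 L η k Ω f m → Bd2 L η k Ω (R f) (BR * m))
    (hW : Bd2 L η k Ω W mW) (hcV : 0 ≤ cV) (hBR : 0 ≤ BR) (hmW : 0 ≤ mW) (hθ : cV * BR ≤ 1 / 2) (n : ℕ) :
    Bd2 L η k Ω (Zseq W V R n - Zsol W V R) ((cV * BR) ^ n * mW) := by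
  intro j hj x hx
  have hw : 0 < wt L η j ^ 2 := pow_pos (wt_pos hL hη j) 2
  have hθ0 : 0 ≤ cV * BR := by positivity
  have hdist : ∀ n, dist (Zseq W V R n x) (Zseq W V R (n + 1) x) ≤ (cV * BR * mW * (wt L η j ^ 2)⁻¹) * (cV * BR) ^ n := by
    intro n
    have h := (bd2_zseq_sub hVsub hVbd hRsub hRbd hW hcV hBR hmW n).norm_le hL hη hj hx
    rw [dist_eq_norm, ← norm_neg, neg_sub, ← Pi.sub_apply]
    calc ‖(Zseq W V R (n + 1) - Zseq W V R n) x‖ ≤ (cV * BR) ^ (n + 1) * mW * (wt L η j ^ 2)⁻¹ := h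
      _ = (cV * BR * mW * (wt L η j ^ 2)⁻¹) * (cV * BR) ^ n := by ring
  have htail := dist_le_of_le_geometric_of_tendsto (cV * BR) _ (by linarith) hdist
    (tendsto_zsol hL hη hVsub hVbd hRsub hRbd hW hcV hBR hmW hθ hj hx) n
  rw [dist_eq_norm] at htail
  rw [Pi.sub_apply]
  have h1θ : 1 / 2 ≤ 1 - cV * BR := by linarith
  have hwC : wt L η j ^ 2 * (cV * BR * mW * (wt L η j ^ 2)⁻¹) = cV * BR * mW := by
    rw [mul_comm, mul_assoc, inv_mul_cancel₀ hw.ne', mul_one]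
  have hp : 0 ≤ (cV * BR) ^ n * mW := by positivity
  calc wt L η j ^ 2 * ‖Zseq W V R n x - Zsol W V R x‖
      ≤ wt L η j ^ 2 * (cV * BR * mW * (wt L η j ^ 2)⁻¹ * (cV * BR) ^ n / (1 - cV * BR)) :=
        mul_le_mul_of_nonneg_left htail hw.le
    _ = (wt L η j ^ 2 * (cV * BR * mW * (wt L η j ^ 2)⁻¹)) * (cV * BR) ^ n / (1 - cV * BR) := by ring
    _ = cV * BR * ((cV * BR) ^ n * mW) / (1 - cV * BR) := by rw [hwC]; ring
    _ ≤ (cV * BR) ^ n * mW := by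
        rw [div_le_iff₀ (by linarith)]
        calc cV * BR * ((cV * BR) ^ n * mW) ≤ (1 - cV * BR) * ((cV * BR) ^ n * mW) :=
              mul_le_mul_of_nonneg_right (by linarith) hp
          _ = (cV * BR) ^ n * mW * (1 - cV * BR) := by ring

omit [NormOneClass 𝔸] [NormedAlgebra ℂ 𝔸] in
/-- **`|Z|₍₋₂₎ ≤ 2|W|₍₋₂₎`** — the norm of `(I + VR)⁻¹` is at most `1/(1 − c_VB_R) ≤ 2` (p. 92: «the operator in the square bracket in (1.94) is
invertible»). [cite: Balaban1985RegularSpaces, (1.96)–(1.98) p.92] -/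
theorem bd2_zsol (hVsub : ∀ f g : Site d → 𝔸, ∀ j, j ≤ k → ∀ x ∈ Ω j, V f x - V g x = V (f - g) x)
    (hVbd : ∀ f : Site d → 𝔸, ∀ j, j ≤ k → ∀ x ∈ Ω j, ‖V f x‖ ≤ cV * ‖f x‖)
    (hRsub : ∀ f g : Site d → 𝔸, R (f - g) = R f - R g)
    (hRbd : ∀ (f : Site d → 𝔸) (m : ℝ), 0 ≤ m → Bd2 L η k Ω f m → Bd2 L η k Ω (R f) (BR * m))
    (hW : Bd2 L η k Ω W mW) (hcV : 0 ≤ cV) (hBR : 0 ≤ BR) (hmW : 0 ≤ mW) (hθ : cV * BR ≤ 1 / 2) :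
    Bd2 L η k Ω (Zsol W V R) (2 * mW) := by
  intro j hj x hx
  have ht := tendsto_zsol hL hη hVsub hVbd hRsub hRbd hW hcV hBR hmW hθ hj hx
  have hev : ∀ n, wt L η j ^ 2 * ‖Zseq W V R n x‖ ≤ 2 * mW := fun n =>
    bd2_zseq hVsub hVbd hRsub hRbd hW hcV hBR hmW hθ n j hj x hx
  exact le_of_tendsto' ((ht.norm).const_mul _) hev

omit [NormOneClass 𝔸] [NormedAlgebra ℂ 𝔸] in
/-- **THE NEUMANN IDENTITY `Z + V(RZ) = W` on every `Ω_j`** (i.e. `Z = (I + VR)⁻¹W`, (1.96) with `R` pushed through): pass to the limit in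
`Z_{n+1} = W − V(RZ_n)`, using `|V(R(Z_n − Z))| ≤ c_VB_R(c_VB_R)ⁿ|W|₍₋₂₎(Lʲη)⁻² → 0`. [cite: Balaban1985RegularSpaces, (1.96) p.92, (1.94)–(1.95) p.92] -/
theorem zsol_eq (hVsub : ∀ f g : Site d → 𝔸, ∀ j, j ≤ k → ∀ x ∈ Ω j, V f x - V g x = V (f - g) x)
    (hVbd : ∀ f : Site d → 𝔸, ∀ j, j ≤ k → ∀ x ∈ Ω j, ‖V f x‖ ≤ cV * ‖f x‖)
    (hRsub : ∀ f g : Site d → 𝔸, R (f - g) = R f - R g)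
    (hRbd : ∀ (f : Site d → 𝔸) (m : ℝ), 0 ≤ m → Bd2 L η k Ω f m → Bd2 L η k Ω (R f) (BR * m))
    (hW : Bd2 L η k Ω W mW) (hcV : 0 ≤ cV) (hBR : 0 ≤ BR) (hmW : 0 ≤ mW) (hθ : cV * BR ≤ 1 / 2)
    {j : ℕ} (hj : j ≤ k) {x : Site d} (hx : x ∈ Ω j) :
    Zsol W V R x + V (R (Zsol W V R)) x = W x := by
  set Z := Zsol W V R with hZ
  have hw : 0 < wt L η j ^ 2 := pow_pos (wt_pos hL hη j) 2
  have hθ0 : 0 ≤ cV * BR := by positivity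
  have ht := tendsto_zsol hL hη hVsub hVbd hRsub hRbd hW hcV hBR hmW hθ hj hx
  -- `V(R Z_n) x → V(R Z) x`
  have hV : Tendsto (fun n => V (R (Zseq W V R n)) x) atTop (𝓝 (V (R Z) x)) := by
    rw [tendsto_iff_norm_sub_tendsto_zero]
    have hbound : ∀ n, ‖V (R (Zseq W V R n)) x - V (R Z) x‖ ≤ cV * (BR * ((cV * BR) ^ n * mW)) * (wt L η j ^ 2)⁻¹ := by
      intro n
      have htail := bd2_zseq_sub_zsol hL hη hVsub hVbd hRsub hRbd hW hcV hBR hmW hθ n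
      have hR := (hRbd _ _ (by positivity) htail).norm_le hL hη hj hx
      rw [hVsub _ _ j hj x hx, ← hRsub]
      calc ‖V (R (Zseq W V R n - Z)) x‖ ≤ cV * ‖R (Zseq W V R n - Z) x‖ := hVbd _ j hj x hx
        _ ≤ cV * (BR * ((cV * BR) ^ n * mW) * (wt L η j ^ 2)⁻¹) := mul_le_mul_of_nonneg_left hR hcV
        _ = cV * (BR * ((cV * BR) ^ n * mW)) * (wt L η j ^ 2)⁻¹ := by ring
    have hlim : Tendsto (fun n => cV * (BR * ((cV * BR) ^ n * mW)) * (wt L η j ^ 2)⁻¹) atTop (𝓝 0) := by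
      have hp : Tendsto (fun n => (cV * BR) ^ n) atTop (𝓝 0) :=
        tendsto_pow_atTop_nhds_zero_of_lt_one hθ0 (by linarith)
      have : Tendsto (fun n => cV * (BR * ((cV * BR) ^ n * mW)) * (wt L η j ^ 2)⁻¹) atTop
          (𝓝 (cV * (BR * (0 * mW)) * (wt L η j ^ 2)⁻¹)) :=
        ((((hp.mul_const mW).const_mul BR).const_mul cV).mul_const _)
      simpa using this
    exact squeeze_zero_norm' (Eventually.of_forall fun n => by simpa using hbound n) hlim
  -- `Z_{n+1} x = W x − V(R Z_n) x` converges to both `Z x` and `W x − V(R Z) x`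
  have h1 : Tendsto (fun n => Zseq W V R (n + 1) x) atTop (𝓝 (Z x)) := ht.comp (tendsto_add_atTop_nat 1)
  have h2 : Tendsto (fun n => Zseq W V R (n + 1) x) atTop (𝓝 (W x - V (R Z) x)) := by
    have : (fun n => Zseq W V R (n + 1) x) = fun n => W x - V (R (Zseq W V R n)) x := by
      funext n; exact zseq_succ W V R n x
    rw [this]
    exact tendsto_const_nhds.sub hV
  have heq := tendsto_nhds_unique h1 h2
  rw [heq]; abel

omit [NormOneClass 𝔸] [NormedAlgebra ℂ 𝔸] in
/-- **LIPSCHITZ DEPENDENCE OF `Z = (I + VR)⁻¹W` ON THE DATA `(W, V)`** (the resolvent recursion): for two data `(W₁, V₁)`, `(W₂, V₂)` with the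
standing bounds, `|W₁ − W₂|₍₋₂₎ ≤ δ_W` and `|(V₁ − V₂)g| ≤ δ_V|g|` on the `Ω_j`: `|Z₁ − Z₂|₍₋₂₎ ≤ 2(δ_W + δ_V·B_R·2|W|₍₋₂₎)` — from
`Z₁,ₙ₊₁ − Z₂,ₙ₊₁ = (W₁ − W₂) − V₁(R(Z₁,ₙ − Z₂,ₙ)) − (V₁ − V₂)(RZ₂,ₙ)` and `c_VB_R ≤ ½`. [cite: Balaban1985RegularSpaces, (1.104)–(1.106) p.94, (1.96) p.92] -/
theorem bd2_zsol_sub_zsol {W₁ W₂ : Site d → 𝔸} {V₁ V₂ : (Site d → 𝔸) → (Site d → 𝔸)} {δW δV : ℝ}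
    (hVsub₁ : ∀ f g : Site d → 𝔸, ∀ j, j ≤ k → ∀ x ∈ Ω j, V₁ f x - V₁ g x = V₁ (f - g) x)
    (hVbd₁ : ∀ f : Site d → 𝔸, ∀ j, j ≤ k → ∀ x ∈ Ω j, ‖V₁ f x‖ ≤ cV * ‖f x‖)
    (hVsub₂ : ∀ f g : Site d → 𝔸, ∀ j, j ≤ k → ∀ x ∈ Ω j, V₂ f x - V₂ g x = V₂ (f - g) x)
    (hVbd₂ : ∀ f : Site d → 𝔸, ∀ j, j ≤ k → ∀ x ∈ Ω j, ‖V₂ f x‖ ≤ cV * ‖f x‖)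
    (hRsub : ∀ f g : Site d → 𝔸, R (f - g) = R f - R g)
    (hRbd : ∀ (f : Site d → 𝔸) (m : ℝ), 0 ≤ m → Bd2 L η k Ω f m → Bd2 L η k Ω (R f) (BR * m))
    (hW₁ : Bd2 L η k Ω W₁ mW) (hW₂ : Bd2 L η k Ω W₂ mW) (hcV : 0 ≤ cV) (hBR : 0 ≤ BR) (hmW : 0 ≤ mW) (hθ : cV * BR ≤ 1 / 2)
    (hδW : 0 ≤ δW) (hδV : 0 ≤ δV) (hdW : Bd2 L η k Ω (W₁ - W₂) δW)
    (hdV : ∀ g : Site d → 𝔸, ∀ j, j ≤ k → ∀ x ∈ Ω j, ‖V₁ g x - V₂ g x‖ ≤ δV * ‖g x‖) :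
    Bd2 L η k Ω (Zsol W₁ V₁ R - Zsol W₂ V₂ R) (2 * (δW + δV * (BR * (2 * mW)))) := by
  set c := δW + δV * (BR * (2 * mW)) with hc
  have hc0 : 0 ≤ c := by positivity
  have hθ0 : 0 ≤ cV * BR := by positivity
  -- the recursion on the iterates
  have hcW : δW ≤ c := by
    rw [hc]; linarith [show 0 ≤ δV * (BR * (2 * mW)) by positivity]
  have main : ∀ n, Bd2 L η k Ω (Zseq W₁ V₁ R n - Zseq W₂ V₂ R n) (2 * c) := by
    intro n
    induction n with
    | zero => simpa [zseq_zero] using hdW.mono (by linarith)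
    | succ n ih =>
      intro j hj x hx
      have hw : 0 ≤ wt L η j ^ 2 := sq_nonneg _
      -- three pieces
      have hA := hdW j hj x hx
      have hB : wt L η j ^ 2 * ‖V₁ (R (Zseq W₁ V₁ R n - Zseq W₂ V₂ R n)) x‖ ≤ cV * BR * (2 * c) := by
        have hR := hRbd _ _ (by positivity) ih j hj x hx
        calc wt L η j ^ 2 * ‖V₁ (R (Zseq W₁ V₁ R n - Zseq W₂ V₂ R n)) x‖
            ≤ wt L η j ^ 2 * (cV * ‖R (Zseq W₁ V₁ R n - Zseq W₂ V₂ R n) x‖) :=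
              mul_le_mul_of_nonneg_left (hVbd₁ _ j hj x hx) hw
          _ = cV * (wt L η j ^ 2 * ‖R (Zseq W₁ V₁ R n - Zseq W₂ V₂ R n) x‖) := by ring
          _ ≤ cV * (BR * (2 * c)) := mul_le_mul_of_nonneg_left hR hcV
          _ = cV * BR * (2 * c) := by ring
      have hC : wt L η j ^ 2 * ‖V₁ (R (Zseq W₂ V₂ R n)) x - V₂ (R (Zseq W₂ V₂ R n)) x‖ ≤ δV * (BR * (2 * mW)) := by
        have hZ₂ := bd2_zseq hVsub₂ hVbd₂ hRsub hRbd hW₂ hcV hBR hmW hθ n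
        have hR := hRbd _ _ (by positivity) hZ₂ j hj x hx
        calc wt L η j ^ 2 * ‖V₁ (R (Zseq W₂ V₂ R n)) x - V₂ (R (Zseq W₂ V₂ R n)) x‖
            ≤ wt L η j ^ 2 * (δV * ‖R (Zseq W₂ V₂ R n) x‖) := mul_le_mul_of_nonneg_left (hdV _ j hj x hx) hw
          _ = δV * (wt L η j ^ 2 * ‖R (Zseq W₂ V₂ R n) x‖) := by ring
          _ ≤ δV * (BR * (2 * mW)) := mul_le_mul_of_nonneg_left hR hδV
      have heq : (Zseq W₁ V₁ R (n + 1) - Zseq W₂ V₂ R (n + 1)) x =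
          (W₁ - W₂) x - V₁ (R (Zseq W₁ V₁ R n - Zseq W₂ V₂ R n)) x -
            (V₁ (R (Zseq W₂ V₂ R n)) x - V₂ (R (Zseq W₂ V₂ R n)) x) := by
        simp only [Pi.sub_apply, zseq_succ]
        rw [hRsub, ← hVsub₁ _ _ j hj x hx]; abel
      rw [heq]
      calc wt L η j ^ 2 * ‖(W₁ - W₂) x - V₁ (R (Zseq W₁ V₁ R n - Zseq W₂ V₂ R n)) x -
              (V₁ (R (Zseq W₂ V₂ R n)) x - V₂ (R (Zseq W₂ V₂ R n)) x)‖
          ≤ wt L η j ^ 2 * (‖(W₁ - W₂) x‖ + ‖V₁ (R (Zseq W₁ V₁ R n - Zseq W₂ V₂ R n)) x‖ +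
              ‖V₁ (R (Zseq W₂ V₂ R n)) x - V₂ (R (Zseq W₂ V₂ R n)) x‖) :=
            mul_le_mul_of_nonneg_left (norm_sub_le_of_le (norm_sub_le _ _) le_rfl) hw
        _ ≤ δW + cV * BR * (2 * c) + δV * (BR * (2 * mW)) := by rw [mul_add, mul_add]; exact add_le_add (add_le_add hA hB) hC
        _ = c + cV * BR * (2 * c) := by rw [hc]; ring
        _ ≤ 2 * c := by nlinarith
  -- pass to the limit
  intro j hj x hx
  have ht₁ := tendsto_zsol hL hη hVsub₁ hVbd₁ hRsub hRbd hW₁ hcV hBR hmW hθ hj hx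
  have ht₂ := tendsto_zsol hL hη hVsub₂ hVbd₂ hRsub hRbd hW₂ hcV hBR hmW hθ hj hx
  have hev : ∀ n, wt L η j ^ 2 * ‖Zseq W₁ V₁ R n x - Zseq W₂ V₂ R n x‖ ≤ 2 * c := fun n => by
    simpa only [Pi.sub_apply] using main n j hj x hx
  have hlim := le_of_tendsto' (((ht₁.sub ht₂).norm).const_mul (wt L η j ^ 2)) hev
  simpa only [Pi.sub_apply] using hlim

end Neumann


/-! ## §3 The concrete `V` and `W` of (1.88)/(1.94) at a gauge parameter `a = λ′`, their sizes ((1.98)V, (1.99)) and Lipschitz moduli -/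

section Concrete

/-- **print's `V = g(i ad_{λ′}) − 1`** (p. 92: «a very simple local operator of the form (Vf)(x) = V(x)f(x)») at the gauge parameter `a`:
`(V_a f)(x) = g(i ad_{a(x)})f(x) − f(x)`. [cite: Balaban1985RegularSpaces, (1.94), (1.98) p.92] -/
def Vop (a f : Site d → 𝔸) (x : Site d) : 𝔸 := gAd (f x) (a x) - f x

/-- **The source `W` of the linearised (1.88)** at the gauge parameter `a` with linearisation defect `E` (`Δλ′ = Δλ + E`), datum `D*A = DA` and bond
field `A`: `W(x) = e^{−i ad_{a(x)}}(DA)(x) + g(i ad_{a(x)})E(x) + Σ_μ 𝔉₃,μ(a, A)(x)`, so that (1.88) reads `D*A′ = Δλ + V_a(Δλ) + W`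
(`B8Prop5KLevelLetters.covDivB_logCfg_gaugeFixed` regrouped, `gAd_add`). [cite: Balaban1985RegularSpaces, (1.88) p.91, (1.93)–(1.95) p.92] -/
def Wsrc (η : ℝ) (U₀ : Site d → Fin d → 𝔸ˣ) (A : Site d → Fin d → 𝔸) (DA a E : Site d → 𝔸) (x : Site d) : 𝔸 :=
  conjR (gaugeExp a x)⁻¹ (DA x) + gAd (E x) (a x) + ∑ μ, frakF3 η U₀ a A x μ

omit [NormOneClass 𝔸] in
/-- `V_a` is sitewise linear: `V_a f − V_a g = V_a(f − g)` at every site with `‖a(x)‖ ≤ 1/12`. [cite: Balaban1985RegularSpaces, (1.94) p.92] -/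
theorem Vop_sub {a : Site d → 𝔸} (f g : Site d → 𝔸) {x : Site d} (ha : ‖a x‖ ≤ 1 / 12) :
    Vop a f x - Vop a g x = Vop a (f - g) x := by
  simp only [Vop, Pi.sub_apply]
  rw [sub_eq_add_neg (f x) (g x), gAd_add _ _ ha, gAd_neg _ ha]; abel

omit [NormOneClass 𝔸] in
/-- **print's «|V| ≤ O(α₄)»**: `‖(V_a f)(x)‖ ≤ 10a₁‖f(x)‖` when `‖a(x)‖ ≤ a₁ ≤ 1/12`. [cite: Balaban1985RegularSpaces, (1.98) p.92] -/
theorem norm_Vop_le {a : Site d → 𝔸} (f : Site d → 𝔸) {x : Site d} {a₁ : ℝ} (ha : ‖a x‖ ≤ a₁) (ha₁ : a₁ ≤ 1 / 12) :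
    ‖Vop a f x‖ ≤ 10 * a₁ * ‖f x‖ := by
  have h := norm_gAd_sub_self_le_mul (f x) (ha.trans ha₁)
  rw [Vop]
  calc ‖gAd (f x) (a x) - f x‖ ≤ 10 * ‖a x‖ * ‖f x‖ := h
    _ ≤ 10 * a₁ * ‖f x‖ := by gcongr

omit [NormOneClass 𝔸] in
/-- **`V_a − V_b` is small with `a − b`**: `‖(V_a f)(x) − (V_b f)(x)‖ ≤ 10‖f(x)‖‖a(x) − b(x)‖` (`‖a(x)‖, ‖b(x)‖ ≤ 1/12`).
[cite: Balaban1985RegularSpaces, (1.104)–(1.106) p.94] -/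
theorem norm_Vop_sub_Vop_le {a b : Site d → 𝔸} (f : Site d → 𝔸) {x : Site d} (ha : ‖a x‖ ≤ 1 / 12) (hb : ‖b x‖ ≤ 1 / 12) :
    ‖Vop a f x - Vop b f x‖ ≤ 10 * ‖f x‖ * ‖a x - b x‖ := by
  have h := norm_gAd_sub_gAd_le (f x) ha hb
  have heq : Vop a f x - Vop b f x = gAd (f x) (a x) - gAd (f x) (b x) := by simp only [Vop]; abel
  rw [heq]; exact h

omit [NormOneClass 𝔸] [NormedAlgebra ℂ 𝔸] [CompleteSpace 𝔸] in
/-- `D*_μ` of a difference (linearity of (1.1)₂). [cite: Balaban1985RegularSpaces, (1.1) p.76] -/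
theorem covDeriv_sub' [NormedAlgebra ℂ 𝔸] (η : ℝ) (U₀ : Site d → Fin d → 𝔸ˣ) (μ : Fin d) (f g : Site d → 𝔸) (x : Site d) :
    covDeriv η U₀ μ (f - g) x = covDeriv η U₀ μ f x - covDeriv η U₀ μ g x := by
  simp only [covDeriv, Pi.sub_apply, conjR_sub, ← smul_sub]
  congr 1; abel

/-- From a weighted bound to the `η`-bound of the (1.82)–(1.89) lemmas: `(Lʲη)‖D‖ ≤ b` gives `η‖D‖ ≤ b` (`L ≥ 1`, `η > 0`).
[cite: Balaban1985RegularSpaces, (1.83), (1.85) p.90] -/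
theorem eta_mul_le_of_wt_mul_le {L : ℕ} (hL : 1 ≤ L) {η : ℝ} (hη : 0 < η) (j : ℕ) {t b : ℝ} (ht : 0 ≤ t)
    (h : wt L η j * t ≤ b) : η * t ≤ b := by
  have hLj : (1 : ℝ) ≤ (L : ℝ) ^ j := one_le_pow₀ (by exact_mod_cast hL)
  have : η * t ≤ wt L η j * t := by
    unfold wt
    have : η ≤ (L : ℝ) ^ j * η := by nlinarith
    exact mul_le_mul_of_nonneg_right this ht
  exact this.trans h

/-- The conjugation of (1.88) in weighted form: `‖e^{−i ad_{a(x)}}Y‖ ≤ (6/5)‖Y‖` for `‖a(x)‖ ≤ 1/12`.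
[cite: Balaban1985RegularSpaces, (1.88) p.91] -/
theorem norm_conj_gaugeExp_le {a : Site d → 𝔸} {x : Site d} (ha : ‖a x‖ ≤ 1 / 12) (Y : 𝔸) :
    ‖conjR (gaugeExp a x)⁻¹ Y‖ ≤ 6 / 5 * ‖Y‖ := by
  rw [gaugeExp, conjR_expUnit_inv_eq]
  have h := norm_conjExp_le (I • a x) Y
  rw [norm_I_smul'] at h
  have he : Real.exp (2 * ‖a x‖) ≤ 6 / 5 := (Real.exp_le_exp.mpr (by linarith)).trans rexp_one_sixth_le
  exact h.trans (mul_le_mul_of_nonneg_right he (norm_nonneg Y))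

/-- The conjugation of (1.88) is Lipschitz in the gauge parameter: `‖e^{−i ad_{a(x)}}Y − e^{−i ad_{b(x)}}Y‖ ≤ 18‖a(x) − b(x)‖‖Y‖` (`‖a(x)‖, ‖b(x)‖ ≤ ½`).
[cite: Balaban1985RegularSpaces, (1.104)–(1.106) p.94] -/
theorem norm_conj_gaugeExp_sub_le {a b : Site d → 𝔸} {x : Site d} (ha : ‖a x‖ ≤ 1 / 2) (hb : ‖b x‖ ≤ 1 / 2) (Y : 𝔸) :
    ‖conjR (gaugeExp a x)⁻¹ Y - conjR (gaugeExp b x)⁻¹ Y‖ ≤ 18 * ‖a x - b x‖ * ‖Y‖ := by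
  rw [gaugeExp, gaugeExp, conjR_expUnit_inv_eq, conjR_expUnit_inv_eq]
  have h := norm_conjExp_sub_conjExp_le (Z₁ := I • a x) (Z₂ := I • b x) (by rwa [norm_I_smul']) (by rwa [norm_I_smul']) Y
  rwa [← smul_sub, norm_I_smul'] at h

variable {L k : ℕ} {η : ℝ} {Ω : ℕ → Set (Site d)} {U₀ : Site d → Fin d → 𝔸ˣ} {A : Site d → Fin d → 𝔸} {DA : Site d → 𝔸}

/-- **THE SIZE OF `𝔉₃` in weighted form** ((1.89) by name, `B8Eq188Proof.norm_frakF3_le`): at `x ∈ Ω_j` with `‖a(x)‖ ≤ 1/12`,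
`(Lʲη)‖D_μa(x)‖, (Lʲη)‖D*_μa(x)‖ ≤ b₁ ≤ 1/70`, `(Lʲη)‖A_μ(x)‖, (Lʲη)‖R(U₀)A_μ(x − e_μ)‖ ≤ c_A ≤ 1/12`:
`(Lʲη)²‖𝔉₃,μ(x)‖ ≤ 82b₁² + 34c_Ab₁`. [cite: Balaban1985RegularSpaces, (1.89) p.91] -/
theorem wt_sq_norm_frakF3_le (hL : 1 ≤ L) (hη : 0 < η) {a : Site d → 𝔸} {j : ℕ} {x : Site d} (μ : Fin d) {b₁ cA : ℝ}
    (hb70 : b₁ ≤ 1 / 70) (hcA : 0 ≤ cA) (hcA12 : cA ≤ 1 / 12) (ha : ‖a x‖ ≤ 1 / 12)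
    (hD : wt L η j * ‖covDerivFwd η U₀ μ a x‖ ≤ b₁) (hDs : wt L η j * ‖covDeriv η U₀ μ a x‖ ≤ b₁)
    (hA : wt L η j * ‖A x μ‖ ≤ cA) (hY : wt L η j * ‖conjR (U₀ (x - e μ) μ)⁻¹ (A (x - e μ) μ)‖ ≤ cA) :
    wt L η j ^ 2 * ‖frakF3 η U₀ a A x μ‖ ≤ 82 * b₁ ^ 2 + 34 * cA * b₁ := by
  set w := wt L η j with hw
  have hw0 : 0 < w := wt_pos hL hη j
  have h := norm_frakF3_le hη U₀ A μ ha
    ((eta_mul_le_of_wt_mul_le hL hη j (norm_nonneg _) hD).trans hb70)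
    ((eta_mul_le_of_wt_mul_le hL hη j (norm_nonneg _) hDs).trans hb70)
    ((eta_mul_le_of_wt_mul_le hL hη j (norm_nonneg _) hA).trans hcA12)
    ((eta_mul_le_of_wt_mul_le hL hη j (norm_nonneg _) hY).trans hcA12)
  set D := ‖covDerivFwd η U₀ μ a x‖
  set Ds := ‖covDeriv η U₀ μ a x‖
  set nA := ‖A x μ‖
  set nY := ‖conjR (U₀ (x - e μ) μ)⁻¹ (A (x - e μ) μ)‖
  have hD0 : 0 ≤ D := norm_nonneg _
  have hDs0 : 0 ≤ Ds := norm_nonneg _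
  have hA0 : 0 ≤ nA := norm_nonneg _
  have hY0 : 0 ≤ nY := norm_nonneg _
  have e1 : w ^ 2 * Ds ^ 2 ≤ b₁ ^ 2 := by
    rw [← mul_pow]; exact pow_le_pow_left₀ (by positivity) hDs 2
  have e2 : w ^ 2 * D ^ 2 ≤ b₁ ^ 2 := by
    rw [← mul_pow]; exact pow_le_pow_left₀ (by positivity) hD 2
  have e3 : w ^ 2 * (nY * Ds) ≤ cA * b₁ := by
    calc w ^ 2 * (nY * Ds) = (w * nY) * (w * Ds) := by ring
      _ ≤ cA * b₁ := mul_le_mul hY hDs (by positivity) hcA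
  have e4 : w ^ 2 * (nA * D) ≤ cA * b₁ := by
    calc w ^ 2 * (nA * D) = (w * nA) * (w * D) := by ring
      _ ≤ cA * b₁ := mul_le_mul hA hD (by positivity) hcA
  calc w ^ 2 * ‖frakF3 η U₀ a A x μ‖ ≤ w ^ 2 * (41 * Ds ^ 2 + 41 * D ^ 2 + 17 * nY * Ds + 17 * nA * D) :=
        mul_le_mul_of_nonneg_left h (sq_nonneg _)
    _ = 41 * (w ^ 2 * Ds ^ 2) + 41 * (w ^ 2 * D ^ 2) + 17 * (w ^ 2 * (nY * Ds)) + 17 * (w ^ 2 * (nA * D)) := by ring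
    _ ≤ 41 * b₁ ^ 2 + 41 * b₁ ^ 2 + 17 * (cA * b₁) + 17 * (cA * b₁) := by gcongr
    _ = 82 * b₁ ^ 2 + 34 * cA * b₁ := by ring

/-- **THE SIZE OF `W`** (the source side of (1.99)): at `x ∈ Ω_j`, with the displayed sizes `‖a(x)‖ ≤ 1/12`, `(Lʲη)‖Da‖, (Lʲη)‖D*a‖ ≤ b₁ ≤ 1/70`,
`(Lʲη)²‖E(x)‖ ≤ m_E`, `(Lʲη)²‖DA(x)‖ ≤ c_{DA}`, `(Lʲη)‖A‖ ≤ c_A ≤ 1/12`:  `(Lʲη)²‖W(x)‖ ≤ (6/5)c_{DA} + 2m_E + d(82b₁² + 34c_Ab₁)`.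
[cite: Balaban1985RegularSpaces, (1.99) p.93, (1.89) p.91] -/
theorem wt_sq_norm_Wsrc_le (hL : 1 ≤ L) (hη : 0 < η) {a E : Site d → 𝔸} {j : ℕ} {x : Site d} {b₁ cA mE cDA : ℝ}
    (hb70 : b₁ ≤ 1 / 70) (hcA : 0 ≤ cA) (hcA12 : cA ≤ 1 / 12) (ha : ‖a x‖ ≤ 1 / 12)
    (hD : ∀ μ, wt L η j * ‖covDerivFwd η U₀ μ a x‖ ≤ b₁ ∧ wt L η j * ‖covDeriv η U₀ μ a x‖ ≤ b₁)
    (hA : ∀ μ, wt L η j * ‖A x μ‖ ≤ cA ∧ wt L η j * ‖conjR (U₀ (x - e μ) μ)⁻¹ (A (x - e μ) μ)‖ ≤ cA)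
    (hE : wt L η j ^ 2 * ‖E x‖ ≤ mE) (hDA : wt L η j ^ 2 * ‖DA x‖ ≤ cDA) :
    wt L η j ^ 2 * ‖Wsrc η U₀ A DA a E x‖ ≤ 6 / 5 * cDA + 2 * mE + d * (82 * b₁ ^ 2 + 34 * cA * b₁) := by
  set w := wt L η j with hw
  have hw2 : 0 ≤ w ^ 2 := sq_nonneg _
  have h1 : w ^ 2 * ‖conjR (gaugeExp a x)⁻¹ (DA x)‖ ≤ 6 / 5 * cDA := by
    calc w ^ 2 * ‖conjR (gaugeExp a x)⁻¹ (DA x)‖ ≤ w ^ 2 * (6 / 5 * ‖DA x‖) := mul_le_mul_of_nonneg_left (norm_conj_gaugeExp_le ha _) hw2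
      _ = 6 / 5 * (w ^ 2 * ‖DA x‖) := by ring
      _ ≤ 6 / 5 * cDA := by linarith
  have h2 : w ^ 2 * ‖gAd (E x) (a x)‖ ≤ 2 * mE := by
    calc w ^ 2 * ‖gAd (E x) (a x)‖ ≤ w ^ 2 * (2 * ‖E x‖) := mul_le_mul_of_nonneg_left (norm_gAd_le' _ ha) hw2
      _ = 2 * (w ^ 2 * ‖E x‖) := by ring
      _ ≤ 2 * mE := by linarith
  have h3 : w ^ 2 * ‖∑ μ, frakF3 η U₀ a A x μ‖ ≤ d * (82 * b₁ ^ 2 + 34 * cA * b₁) := by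
    calc w ^ 2 * ‖∑ μ, frakF3 η U₀ a A x μ‖ ≤ w ^ 2 * ∑ μ, ‖frakF3 η U₀ a A x μ‖ :=
          mul_le_mul_of_nonneg_left (norm_sum_le _ _) hw2
      _ = ∑ μ : Fin d, w ^ 2 * ‖frakF3 η U₀ a A x μ‖ := by rw [Finset.mul_sum]
      _ ≤ ∑ _μ : Fin d, (82 * b₁ ^ 2 + 34 * cA * b₁) :=
          Finset.sum_le_sum fun μ _ => wt_sq_norm_frakF3_le hL hη μ hb70 hcA hcA12 ha (hD μ).1 (hD μ).2 (hA μ).1 (hA μ).2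
      _ = d * (82 * b₁ ^ 2 + 34 * cA * b₁) := by rw [Finset.sum_const, Finset.card_univ, Fintype.card_fin, nsmul_eq_mul]
  rw [Wsrc]
  calc w ^ 2 * ‖conjR (gaugeExp a x)⁻¹ (DA x) + gAd (E x) (a x) + ∑ μ, frakF3 η U₀ a A x μ‖
      ≤ w ^ 2 * (‖conjR (gaugeExp a x)⁻¹ (DA x)‖ + ‖gAd (E x) (a x)‖ + ‖∑ μ, frakF3 η U₀ a A x μ‖) :=
        mul_le_mul_of_nonneg_left norm_add₃_le hw2
    _ ≤ 6 / 5 * cDA + 2 * mE + d * (82 * b₁ ^ 2 + 34 * cA * b₁) := by rw [mul_add, mul_add]; exact add_le_add (add_le_add h1 h2) h3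

/-- **THE LIPSCHITZ MODULUS OF `𝔉₃` in the gauge parameter, weighted form**: at `x ∈ Ω_j` with the sizes of `wt_sq_norm_frakF3_le` for BOTH `a` and
`b` (`‖·‖ ≤ 1/24`, `b₁ ∈ ]0, 1/140]`, `c_A ≤ 1/13`) and the moduli `‖a(x) − b(x)‖ ≤ δ₀`, `(Lʲη)‖D_μ(a − b)(x)‖, (Lʲη)‖D*_μ(a − b)(x)‖ ≤ δ₁`:
`(Lʲη)²‖𝔉₃,μ(a)(x) − 𝔉₃,μ(b)(x)‖ ≤ 438b₁δ₁ + 1968b₁²δ₀ + 68c_Aδ₁ + 808c_Ab₁δ₀` (`norm_frakF1_sub_le`, `norm_frakF2_sub_le`).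
[cite: Balaban1985RegularSpaces, (1.104)–(1.106) p.94, (1.89) p.91] -/
theorem wt_sq_norm_frakF3_sub_le (hL : 1 ≤ L) (hη : 0 < η) {a b : Site d → 𝔸} {j : ℕ} {x : Site d} (μ : Fin d) {b₁ cA δ₀ δ₁ : ℝ}
    (hb₁ : 0 < b₁) (hb140 : b₁ ≤ 1 / 140) (hcA : 0 ≤ cA) (hcA13 : cA ≤ 1 / 13)
    (ha : ‖a x‖ ≤ 1 / 24) (hb : ‖b x‖ ≤ 1 / 24)
    (hDa : wt L η j * ‖covDerivFwd η U₀ μ a x‖ ≤ b₁) (hDsa : wt L η j * ‖covDeriv η U₀ μ a x‖ ≤ b₁)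
    (hDb : wt L η j * ‖covDerivFwd η U₀ μ b x‖ ≤ b₁) (hDsb : wt L η j * ‖covDeriv η U₀ μ b x‖ ≤ b₁)
    (hA : wt L η j * ‖A x μ‖ ≤ cA) (hY : wt L η j * ‖conjR (U₀ (x - e μ) μ)⁻¹ (A (x - e μ) μ)‖ ≤ cA)
    (hd₀ : ‖a x - b x‖ ≤ δ₀) (hd₁ : wt L η j * ‖covDerivFwd η U₀ μ (a - b) x‖ ≤ δ₁)
    (hd₁s : wt L η j * ‖covDeriv η U₀ μ (a - b) x‖ ≤ δ₁) :
    wt L η j ^ 2 * ‖frakF3 η U₀ a A x μ - frakF3 η U₀ b A x μ‖ ≤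
      438 * b₁ * δ₁ + 1968 * b₁ ^ 2 * δ₀ + 68 * cA * δ₁ + 808 * cA * b₁ * δ₀ := by
  set w := wt L η j with hw
  have hw0 : 0 < w := wt_pos hL hη j
  have hw2 : 0 < w ^ 2 := pow_pos hw0 2
  -- unweighted sizes: m := b₁ / w, moduli δ₁ / w, Ab-size cA / w
  set m := b₁ / w with hm
  have hm0 : 0 < m := div_pos hb₁ hw0
  have hLj : (1 : ℝ) ≤ (L : ℝ) ^ j := one_le_pow₀ (by exact_mod_cast hL)
  have hηw : η ≤ w := by rw [hw]; unfold wt; nlinarith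
  have hηm : η * m ≤ b₁ := by
    rw [hm]; calc η * (b₁ / w) ≤ w * (b₁ / w) := by gcongr
      _ = b₁ := by field_simp
  have hm4 : 4 * (η * m) < 1 / 3 := by linarith
  have hmη : η * m ≤ 1 / 140 := hηm.trans hb140
  have unw : ∀ {t c : ℝ}, 0 ≤ t → w * t ≤ c → t ≤ c / w := fun ht h => by rw [le_div_iff₀ hw0, mul_comm]; exact h
  have hDa' := unw (norm_nonneg _) hDa; have hDsa' := unw (norm_nonneg _) hDsa
  have hDb' := unw (norm_nonneg _) hDb; have hDsb' := unw (norm_nonneg _) hDsb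
  have hA' := unw (norm_nonneg _) hA; have hY' := unw (norm_nonneg _) hY
  have hd₁' := unw (norm_nonneg _) hd₁; have hd₁s' := unw (norm_nonneg _) hd₁s
  have hcAη : η * (cA / w) ≤ 1 / 13 := by
    calc η * (cA / w) ≤ w * (cA / w) := by gcongr
      _ = cA := by field_simp
      _ ≤ 1 / 13 := hcA13
  have hA13 : η * ‖A x μ‖ ≤ 1 / 13 := (mul_le_mul_of_nonneg_left hA' hη.le).trans hcAη
  have hY13 : η * ‖-conjR (U₀ (x - e μ) μ)⁻¹ (A (x - e μ) μ)‖ ≤ 1 / 13 := by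
    rw [norm_neg]; exact (mul_le_mul_of_nonneg_left hY' hη.le).trans hcAη
  -- the four pieces
  have P1 := norm_frakF1_sub_le hη hm0 hm4 ha hb hDsa' hDsb'
  have P2 := norm_frakF1_sub_le hη hm0 hm4 ha hb hDa' hDb'
  have P3 := norm_frakF2_sub_le hη hmη ha hb hDsa' hDsb' hY13 (Ab := -conjR (U₀ (x - e μ) μ)⁻¹ (A (x - e μ) μ))
  have P4 := norm_frakF2_sub_le hη hmη ha hb hDa' hDb' hA13 (Ab := A x μ)
  rw [covDerivFwd_sub'] at hd₁'
  rw [covDeriv_sub'] at hd₁s'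
  rw [norm_neg] at P3
  have heq : frakF3 η U₀ a A x μ - frakF3 η U₀ b A x μ =
      -((frakF1 η (a x) (covDeriv η U₀ μ a x) - frakF1 η (b x) (covDeriv η U₀ μ b x)) +
        (frakF1 η (a x) (covDerivFwd η U₀ μ a x) - frakF1 η (b x) (covDerivFwd η U₀ μ b x)) +
        (frakF2 η (a x) (covDeriv η U₀ μ a x) (-conjR (U₀ (x - e μ) μ)⁻¹ (A (x - e μ) μ)) -
          frakF2 η (b x) (covDeriv η U₀ μ b x) (-conjR (U₀ (x - e μ) μ)⁻¹ (A (x - e μ) μ))) +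
        (frakF2 η (a x) (covDerivFwd η U₀ μ a x) (A x μ) - frakF2 η (b x) (covDerivFwd η U₀ μ b x) (A x μ))) := by
    simp only [frakF3]; abel
  rw [heq, norm_neg]
  -- weighted bounds of the four pieces
  have Q1 : w ^ 2 * ‖frakF1 η (a x) (covDeriv η U₀ μ a x) - frakF1 η (b x) (covDeriv η U₀ μ b x)‖ ≤ 219 * b₁ * δ₁ + 984 * b₁ ^ 2 * δ₀ := by
    calc w ^ 2 * ‖frakF1 η (a x) (covDeriv η U₀ μ a x) - frakF1 η (b x) (covDeriv η U₀ μ b x)‖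
        ≤ w ^ 2 * (219 * m * (δ₁ / w) + 984 * m ^ 2 * δ₀) := by
          refine mul_le_mul_of_nonneg_left (P1.trans ?_) hw2.le
          gcongr
      _ = 219 * b₁ * δ₁ + 984 * b₁ ^ 2 * δ₀ := by rw [hm]; field_simp
  have Q2 : w ^ 2 * ‖frakF1 η (a x) (covDerivFwd η U₀ μ a x) - frakF1 η (b x) (covDerivFwd η U₀ μ b x)‖ ≤ 219 * b₁ * δ₁ + 984 * b₁ ^ 2 * δ₀ := by
    calc w ^ 2 * ‖frakF1 η (a x) (covDerivFwd η U₀ μ a x) - frakF1 η (b x) (covDerivFwd η U₀ μ b x)‖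
        ≤ w ^ 2 * (219 * m * (δ₁ / w) + 984 * m ^ 2 * δ₀) := by
          refine mul_le_mul_of_nonneg_left (P2.trans ?_) hw2.le
          gcongr
      _ = 219 * b₁ * δ₁ + 984 * b₁ ^ 2 * δ₀ := by rw [hm]; field_simp
  have Q3 : w ^ 2 * ‖frakF2 η (a x) (covDeriv η U₀ μ a x) (-conjR (U₀ (x - e μ) μ)⁻¹ (A (x - e μ) μ)) -
          frakF2 η (b x) (covDeriv η U₀ μ b x) (-conjR (U₀ (x - e μ) μ)⁻¹ (A (x - e μ) μ))‖ ≤ 34 * cA * δ₁ + 404 * cA * b₁ * δ₀ := by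
    calc w ^ 2 * ‖frakF2 η (a x) (covDeriv η U₀ μ a x) (-conjR (U₀ (x - e μ) μ)⁻¹ (A (x - e μ) μ)) -
          frakF2 η (b x) (covDeriv η U₀ μ b x) (-conjR (U₀ (x - e μ) μ)⁻¹ (A (x - e μ) μ))‖
        ≤ w ^ 2 * (34 * (cA / w) * (δ₁ / w) + 404 * (cA / w) * m * δ₀) := by
          refine mul_le_mul_of_nonneg_left (P3.trans ?_) hw2.le
          gcongr
      _ = 34 * cA * δ₁ + 404 * cA * b₁ * δ₀ := by rw [hm]; field_simp
  have Q4 : w ^ 2 * ‖frakF2 η (a x) (covDerivFwd η U₀ μ a x) (A x μ) - frakF2 η (b x) (covDerivFwd η U₀ μ b x) (A x μ)‖ ≤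
      34 * cA * δ₁ + 404 * cA * b₁ * δ₀ := by
    calc w ^ 2 * ‖frakF2 η (a x) (covDerivFwd η U₀ μ a x) (A x μ) - frakF2 η (b x) (covDerivFwd η U₀ μ b x) (A x μ)‖
        ≤ w ^ 2 * (34 * (cA / w) * (δ₁ / w) + 404 * (cA / w) * m * δ₀) := by
          refine mul_le_mul_of_nonneg_left (P4.trans ?_) hw2.le
          gcongr
      _ = 34 * cA * δ₁ + 404 * cA * b₁ * δ₀ := by rw [hm]; field_simp
  calc w ^ 2 * ‖(frakF1 η (a x) (covDeriv η U₀ μ a x) - frakF1 η (b x) (covDeriv η U₀ μ b x)) +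
        (frakF1 η (a x) (covDerivFwd η U₀ μ a x) - frakF1 η (b x) (covDerivFwd η U₀ μ b x)) +
        (frakF2 η (a x) (covDeriv η U₀ μ a x) (-conjR (U₀ (x - e μ) μ)⁻¹ (A (x - e μ) μ)) -
          frakF2 η (b x) (covDeriv η U₀ μ b x) (-conjR (U₀ (x - e μ) μ)⁻¹ (A (x - e μ) μ))) +
        (frakF2 η (a x) (covDerivFwd η U₀ μ a x) (A x μ) - frakF2 η (b x) (covDerivFwd η U₀ μ b x) (A x μ))‖
      ≤ w ^ 2 * (‖frakF1 η (a x) (covDeriv η U₀ μ a x) - frakF1 η (b x) (covDeriv η U₀ μ b x)‖ +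
          ‖frakF1 η (a x) (covDerivFwd η U₀ μ a x) - frakF1 η (b x) (covDerivFwd η U₀ μ b x)‖ +
          ‖frakF2 η (a x) (covDeriv η U₀ μ a x) (-conjR (U₀ (x - e μ) μ)⁻¹ (A (x - e μ) μ)) -
            frakF2 η (b x) (covDeriv η U₀ μ b x) (-conjR (U₀ (x - e μ) μ)⁻¹ (A (x - e μ) μ))‖ +
          ‖frakF2 η (a x) (covDerivFwd η U₀ μ a x) (A x μ) - frakF2 η (b x) (covDerivFwd η U₀ μ b x) (A x μ)‖) :=
        mul_le_mul_of_nonneg_left ((norm_add_le _ _).trans (add_le_add ((norm_add_le _ _).trans (add_le_add (norm_add_le _ _) le_rfl)) le_rfl)) hw2.le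
    _ ≤ (219 * b₁ * δ₁ + 984 * b₁ ^ 2 * δ₀) + (219 * b₁ * δ₁ + 984 * b₁ ^ 2 * δ₀) + (34 * cA * δ₁ + 404 * cA * b₁ * δ₀) +
          (34 * cA * δ₁ + 404 * cA * b₁ * δ₀) := by
        rw [mul_add, mul_add, mul_add]; exact add_le_add (add_le_add (add_le_add Q1 Q2) Q3) Q4
    _ = 438 * b₁ * δ₁ + 1968 * b₁ ^ 2 * δ₀ + 68 * cA * δ₁ + 808 * cA * b₁ * δ₀ := by ring

/-- **THE LIPSCHITZ MODULUS OF `W` IN `(a, E)`** (the source side of (1.104)–(1.106)), weighted form at `x ∈ Ω_j`: with the sizes of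
`wt_sq_norm_Wsrc_le` for both `(a, E)` and `(b, E′)` (`‖a(x)‖, ‖b(x)‖ ≤ 1/24`, `b₁ ∈ ]0, 1/140]`, `c_A ≤ 1/13`) and the moduli `δ₀`, `δ₁` of `a − b`,
`δ_E` of `E − E′`: `(Lʲη)²‖W(a, E)(x) − W(b, E′)(x)‖ ≤ 18c_{DA}δ₀ + 2δ_E + 10m_Eδ₀ + d(438b₁δ₁ + 1968b₁²δ₀ + 68c_Aδ₁ + 808c_Ab₁δ₀)`.
[cite: Balaban1985RegularSpaces, (1.104)–(1.106) p.94] -/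
theorem wt_sq_norm_Wsrc_sub_le (hL : 1 ≤ L) (hη : 0 < η) {a b E E' : Site d → 𝔸} {j : ℕ} {x : Site d} {b₁ cA mE cDA δ₀ δ₁ δE : ℝ}
    (hb₁ : 0 < b₁) (hb140 : b₁ ≤ 1 / 140) (hcA : 0 ≤ cA) (hcA13 : cA ≤ 1 / 13) (hδ₀ : 0 ≤ δ₀)
    (ha : ‖a x‖ ≤ 1 / 24) (hb : ‖b x‖ ≤ 1 / 24)
    (hDa : ∀ μ, wt L η j * ‖covDerivFwd η U₀ μ a x‖ ≤ b₁ ∧ wt L η j * ‖covDeriv η U₀ μ a x‖ ≤ b₁)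
    (hDb : ∀ μ, wt L η j * ‖covDerivFwd η U₀ μ b x‖ ≤ b₁ ∧ wt L η j * ‖covDeriv η U₀ μ b x‖ ≤ b₁)
    (hA : ∀ μ, wt L η j * ‖A x μ‖ ≤ cA ∧ wt L η j * ‖conjR (U₀ (x - e μ) μ)⁻¹ (A (x - e μ) μ)‖ ≤ cA)
    (hE' : wt L η j ^ 2 * ‖E' x‖ ≤ mE) (hDA : wt L η j ^ 2 * ‖DA x‖ ≤ cDA)
    (hd₀ : ‖a x - b x‖ ≤ δ₀)
    (hd₁ : ∀ μ, wt L η j * ‖covDerivFwd η U₀ μ (a - b) x‖ ≤ δ₁ ∧ wt L η j * ‖covDeriv η U₀ μ (a - b) x‖ ≤ δ₁)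
    (hdE : wt L η j ^ 2 * ‖E x - E' x‖ ≤ δE) :
    wt L η j ^ 2 * ‖Wsrc η U₀ A DA a E x - Wsrc η U₀ A DA b E' x‖ ≤
      18 * cDA * δ₀ + 2 * δE + 10 * mE * δ₀ + d * (438 * b₁ * δ₁ + 1968 * b₁ ^ 2 * δ₀ + 68 * cA * δ₁ + 808 * cA * b₁ * δ₀) := by
  set w := wt L η j with hw
  have hw2 : 0 ≤ w ^ 2 := sq_nonneg _
  have ha12 : ‖a x‖ ≤ 1 / 12 := by linarith
  have hb12 : ‖b x‖ ≤ 1 / 12 := by linarith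
  -- (i) the conjugation
  have h1 : w ^ 2 * ‖conjR (gaugeExp a x)⁻¹ (DA x) - conjR (gaugeExp b x)⁻¹ (DA x)‖ ≤ 18 * cDA * δ₀ := by
    have h := norm_conj_gaugeExp_sub_le (a := a) (b := b) (x := x) (by linarith) (by linarith) (DA x)
    calc w ^ 2 * ‖conjR (gaugeExp a x)⁻¹ (DA x) - conjR (gaugeExp b x)⁻¹ (DA x)‖ ≤ w ^ 2 * (18 * ‖a x - b x‖ * ‖DA x‖) :=
          mul_le_mul_of_nonneg_left h hw2
      _ = 18 * ‖a x - b x‖ * (w ^ 2 * ‖DA x‖) := by ring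
      _ ≤ 18 * δ₀ * cDA := by gcongr
      _ = 18 * cDA * δ₀ := by ring
  -- (ii) the g(i ad)E term
  have h2 : w ^ 2 * ‖gAd (E x) (a x) - gAd (E' x) (b x)‖ ≤ 2 * δE + 10 * mE * δ₀ := by
    have hsplit : gAd (E x) (a x) - gAd (E' x) (b x) = gAd (E x - E' x) (a x) + (gAd (E' x) (a x) - gAd (E' x) (b x)) := by
      rw [sub_eq_add_neg (E x) (E' x), gAd_add _ _ ha12, gAd_neg _ ha12]; abel
    rw [hsplit]
    have hp : ‖gAd (E x - E' x) (a x)‖ ≤ 2 * ‖E x - E' x‖ := norm_gAd_le' _ ha12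
    have hq : ‖gAd (E' x) (a x) - gAd (E' x) (b x)‖ ≤ 10 * ‖E' x‖ * ‖a x - b x‖ := norm_gAd_sub_gAd_le _ ha12 hb12
    calc w ^ 2 * ‖gAd (E x - E' x) (a x) + (gAd (E' x) (a x) - gAd (E' x) (b x))‖
        ≤ w ^ 2 * (2 * ‖E x - E' x‖ + 10 * ‖E' x‖ * ‖a x - b x‖) :=
          mul_le_mul_of_nonneg_left ((norm_add_le _ _).trans (add_le_add hp hq)) hw2
      _ = 2 * (w ^ 2 * ‖E x - E' x‖) + 10 * (w ^ 2 * ‖E' x‖) * ‖a x - b x‖ := by ring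
      _ ≤ 2 * δE + 10 * mE * δ₀ := by
          have hmE : 0 ≤ mE := le_trans (by positivity) hE'
          gcongr
  -- (iii) the 𝔉₃ sum
  have h3 : w ^ 2 * ‖∑ μ, frakF3 η U₀ a A x μ - ∑ μ, frakF3 η U₀ b A x μ‖ ≤
      d * (438 * b₁ * δ₁ + 1968 * b₁ ^ 2 * δ₀ + 68 * cA * δ₁ + 808 * cA * b₁ * δ₀) := by
    rw [← Finset.sum_sub_distrib]
    calc w ^ 2 * ‖∑ μ, (frakF3 η U₀ a A x μ - frakF3 η U₀ b A x μ)‖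
        ≤ w ^ 2 * ∑ μ, ‖frakF3 η U₀ a A x μ - frakF3 η U₀ b A x μ‖ := mul_le_mul_of_nonneg_left (norm_sum_le _ _) hw2
      _ = ∑ μ : Fin d, w ^ 2 * ‖frakF3 η U₀ a A x μ - frakF3 η U₀ b A x μ‖ := by rw [Finset.mul_sum]
      _ ≤ ∑ _μ : Fin d, (438 * b₁ * δ₁ + 1968 * b₁ ^ 2 * δ₀ + 68 * cA * δ₁ + 808 * cA * b₁ * δ₀) :=
          Finset.sum_le_sum fun μ _ => wt_sq_norm_frakF3_sub_le hL hη μ hb₁ hb140 hcA hcA13 ha hb (hDa μ).1 (hDa μ).2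
            (hDb μ).1 (hDb μ).2 (hA μ).1 (hA μ).2 hd₀ (hd₁ μ).1 (hd₁ μ).2
      _ = d * (438 * b₁ * δ₁ + 1968 * b₁ ^ 2 * δ₀ + 68 * cA * δ₁ + 808 * cA * b₁ * δ₀) := by
          rw [Finset.sum_const, Finset.card_univ, Fintype.card_fin, nsmul_eq_mul]
  have heq : Wsrc η U₀ A DA a E x - Wsrc η U₀ A DA b E' x =
      (conjR (gaugeExp a x)⁻¹ (DA x) - conjR (gaugeExp b x)⁻¹ (DA x)) + (gAd (E x) (a x) - gAd (E' x) (b x)) +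
        (∑ μ, frakF3 η U₀ a A x μ - ∑ μ, frakF3 η U₀ b A x μ) := by
    simp only [Wsrc]; abel
  rw [heq]
  calc w ^ 2 * ‖(conjR (gaugeExp a x)⁻¹ (DA x) - conjR (gaugeExp b x)⁻¹ (DA x)) + (gAd (E x) (a x) - gAd (E' x) (b x)) +
        (∑ μ, frakF3 η U₀ a A x μ - ∑ μ, frakF3 η U₀ b A x μ)‖
      ≤ w ^ 2 * (‖conjR (gaugeExp a x)⁻¹ (DA x) - conjR (gaugeExp b x)⁻¹ (DA x)‖ + ‖gAd (E x) (a x) - gAd (E' x) (b x)‖ +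
          ‖∑ μ, frakF3 η U₀ a A x μ - ∑ μ, frakF3 η U₀ b A x μ‖) := mul_le_mul_of_nonneg_left norm_add₃_le hw2
    _ ≤ 18 * cDA * δ₀ + (2 * δE + 10 * mE * δ₀) + d * (438 * b₁ * δ₁ + 1968 * b₁ ^ 2 * δ₀ + 68 * cA * δ₁ + 808 * cA * b₁ * δ₀) := by
        rw [mul_add, mul_add]; exact add_le_add (add_le_add h1 h2) h3
    _ = _ := by ring

end Concrete


/-! ## §4 The fixed point of (1.100) in the domain (1.102) at `k` levels -/

section Assembly

/-- **The size `m_W` of the source `W`** ((1.99)'s source side; `wt_sq_norm_Wsrc_le`): `(6/5)c_{DA} + 2m_E + d(82b₁² + 34c_Ab₁)`.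
[cite: Balaban1985RegularSpaces, (1.99) p.93] -/
def mWc (d : ℕ) (b₁ cA mE cDA : ℝ) : ℝ := 6 / 5 * cDA + 2 * mE + d * (82 * b₁ ^ 2 + 34 * cA * b₁)

/-- **The size `M` of the nonlinearity `Ψ = R(−Z)`** ((1.98)R + (1.99): `|Ψ|₍₋₂₎ ≤ B_R·2m_W`). [cite: Balaban1985RegularSpaces, (1.99) p.93, (1.101) p.93] -/
def Mc (d : ℕ) (BR b₁ cA mE cDA : ℝ) : ℝ := BR * (2 * mWc d b₁ cA mE cDA)

/-- **The Lipschitz modulus `K_W` of the source `W`** per unit `‖s − t‖` (`wt_sq_norm_Wsrc_sub_le` at `δ₀ = ℓ₀`, `δ₁ = ℓ₁`, `δ_E = K_E`).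
[cite: Balaban1985RegularSpaces, (1.106) p.94] -/
def KWc (d : ℕ) (b₁ cA mE cDA KE ℓ₀ ℓ₁ : ℝ) : ℝ :=
  18 * cDA * ℓ₀ + 2 * KE + 10 * mE * ℓ₀ + d * (438 * b₁ * ℓ₁ + 1968 * b₁ ^ 2 * ℓ₀ + 68 * cA * ℓ₁ + 808 * cA * b₁ * ℓ₀)

/-- **The Lipschitz modulus `K` of `Ψ = R(−Z)`** ((1.106): `B_R·2(K_W + 10ℓ₀·B_R·2m_W)`, the second summand being the `V(λ₁) − V(λ₂)` piece through
the resolvent recursion). [cite: Balaban1985RegularSpaces, (1.106) p.94] -/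
def Kc (d : ℕ) (BR b₁ cA mE cDA KE ℓ₀ ℓ₁ : ℝ) : ℝ :=
  BR * (2 * (KWc d b₁ cA mE cDA KE ℓ₀ ℓ₁ + 10 * ℓ₀ * (BR * (2 * mWc d b₁ cA mE cDA))))

/-- **THE NONLINEARITY OF (1.100)**, `Ψ(λ) = R(−Z_λ)` with `Z_λ = (I + V_{λ′}R)⁻¹W_λ` (`Zsol`), `λ′ = gpar λ`, `W_λ = Wsrc … (gpar λ) (Eterm λ)`: the fixed-point
equation `λ = G′(Ψ λ)` IS (1.95)/(1.100) for the nonlinearity of (1.88) (see the module docstring: at a solution `Δλ + VΔλ + W = Z − RZ`, so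
`R(D*A′) = 0`). [cite: Balaban1985RegularSpaces, (1.95) p.92, (1.100) p.93] -/
def PsiP5 (η : ℝ) (U₀ : Site d → Fin d → 𝔸ˣ) (A : Site d → Fin d → 𝔸) (DA : Site d → 𝔸) (R gpar Eterm : (Site d → 𝔸) → (Site d → 𝔸))
    (lam : Site d → 𝔸) : Site d → 𝔸 :=
  R (fun x => -Zsol (Wsrc η U₀ A DA (gpar lam) (Eterm lam)) (Vop (gpar lam)) R x)

variable {L k : ℕ} {η : ℝ} {Ω : ℕ → Set (Site d)} {Eb : ℕ → Set (Site d × Fin d)} {U₀ : Site d → Fin d → 𝔸ˣ}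
  {A : Site d → Fin d → 𝔸} {DA : Site d → 𝔸}

/-- `m_W ≥ 0`. [cite: Balaban1985RegularSpaces, (1.99) p.93] -/
theorem mWc_nonneg {b₁ cA mE cDA : ℝ} (hb₁ : 0 ≤ b₁) (hcA : 0 ≤ cA) (hmE : 0 ≤ mE) (hcDA : 0 ≤ cDA) : 0 ≤ mWc d b₁ cA mE cDA := by
  unfold mWc; positivity

/-- `K_W ≥ 0`. [cite: Balaban1985RegularSpaces, (1.106) p.94] -/
theorem KWc_nonneg {b₁ cA mE cDA KE ℓ₀ ℓ₁ : ℝ} (hb₁ : 0 ≤ b₁) (hcA : 0 ≤ cA) (hmE : 0 ≤ mE) (hcDA : 0 ≤ cDA) (hKE : 0 ≤ KE)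
    (hℓ₀ : 0 ≤ ℓ₀) (hℓ₁ : 0 ≤ ℓ₁) : 0 ≤ KWc d b₁ cA mE cDA KE ℓ₀ ℓ₁ := by
  unfold KWc; positivity

/-- **THE FIXED POINT OF (1.100) AT `k` LEVELS, ON THE CONCRETE `ℤᵈ × 𝔸` CARRIERS, FOR THE NONLINEARITY OF (1.88)** — Proposition 5's
contraction (pp. 92–94) run in the domain (1.102) (`B8LambdaSpaceKLevel.lamSubK`): for the letters `Gp` (G′ of [4]: the (1.101)-shape bound
`hG` from `|·|₍₋₂₎` on the `Ω_j`, additive) and `R` ((1.98)R `hRbd`, additive), a gauge-parameter map `gpar` (λ ↦ λ′) with the displayed sizes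
`‖λ′‖ ≤ a₁ ≤ 1/24`, `(Lʲη)‖Dλ′‖, (Lʲη)‖D*λ′‖ ≤ b₁ ∈ ]0, 1/140]` and moduli `ℓ₀`, `ℓ₁` on the closed ¼α₄-ball, a linearisation defect `Eterm`
(λ ↦ Δλ′ − Δλ) of size `m_E` and modulus `K_E` there, the datum `DA = D*A` (`|DA|₍₋₂₎ ≤ c_{DA}`) and `A` (`(Lʲη)‖A‖ ≤ c_A ≤ 1/13` in both bond
positions), under `10a₁B_R ≤ ½` (p. 92: «O(α₄)B′₀² ≤ ½») and the two smallness conditions `B_G·M ≤ ¼α₄` ((1.103), β = ¼) and `B_G·K ≤ ½`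
((1.106)/p. 94 l. 9) on the explicit `M = Mc …`, `K = Kc …`: **there is exactly one `s` with `‖s‖ ≤ ¼α₄` and `λ_s = G′(Ψ λ_s)`**, `Ψ = PsiP5 …`.
Nothing of [4] or of Sect. E is proved: they are the displayed hypotheses. [cite: Balaban1985RegularSpaces, p.94 (after (1.106)), (1.100)–(1.103) p.93, (1.96)–(1.99) pp.92–93] -/
theorem propFive_fixedPoint_kLevel (hL : 1 ≤ L) (hη : 0 < η)
    (Gp R gpar Eterm : (Site d → 𝔸) → (Site d → 𝔸))
    {α₄ BG BR a₁ b₁ cA cDA mE KE ℓ₀ ℓ₁ : ℝ}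
    (hα₄ : 0 ≤ α₄) (hBG : 0 ≤ BG) (hBR : 0 ≤ BR) (ha₁ : 0 ≤ a₁) (ha₁' : a₁ ≤ 1 / 24) (hb₁ : 0 < b₁) (hb₁' : b₁ ≤ 1 / 140)
    (hcA : 0 ≤ cA) (hcA' : cA ≤ 1 / 13) (hcDA : 0 ≤ cDA) (hmE : 0 ≤ mE) (hKE : 0 ≤ KE) (hℓ₀ : 0 ≤ ℓ₀) (hℓ₁ : 0 ≤ ℓ₁)
    (hθ : 10 * a₁ * BR ≤ 1 / 2)
    (hG : ∀ (f : Site d → 𝔸) (m : ℝ), 0 ≤ m → Bd2 L η k Ω f m →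
      (∀ x, ‖Gp f x‖ ≤ BG * m) ∧ ∀ j, j ≤ k → ∀ p ∈ Eb j, wt L η j * ‖covDerivFwd η U₀ p.2 (Gp f) p.1‖ ≤ BG * m)
    (hGsub : ∀ f g : Site d → 𝔸, Gp (f - g) = Gp f - Gp g)
    (hRsub : ∀ f g : Site d → 𝔸, R (f - g) = R f - R g)
    (hRbd : ∀ (f : Site d → 𝔸) (m : ℝ), 0 ≤ m → Bd2 L η k Ω f m → Bd2 L η k Ω (R f) (BR * m))
    (hg0 : ∀ s : lamSubK η U₀ L k Eb, ‖s‖ ≤ α₄ / 4 → ∀ j, j ≤ k → ∀ x ∈ Ω j, ‖gpar (lamOf s) x‖ ≤ a₁)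
    (hg1 : ∀ s : lamSubK η U₀ L k Eb, ‖s‖ ≤ α₄ / 4 → ∀ j, j ≤ k → ∀ x ∈ Ω j, ∀ μ : Fin d,
      wt L η j * ‖covDerivFwd η U₀ μ (gpar (lamOf s)) x‖ ≤ b₁ ∧ wt L η j * ‖covDeriv η U₀ μ (gpar (lamOf s)) x‖ ≤ b₁)
    (hgL : ∀ s t : lamSubK η U₀ L k Eb, ‖s‖ ≤ α₄ / 4 → ‖t‖ ≤ α₄ / 4 → ∀ j, j ≤ k → ∀ x ∈ Ω j,
      ‖gpar (lamOf s) x - gpar (lamOf t) x‖ ≤ ℓ₀ * ‖s - t‖ ∧ ∀ μ : Fin d,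
        wt L η j * ‖covDerivFwd η U₀ μ (gpar (lamOf s) - gpar (lamOf t)) x‖ ≤ ℓ₁ * ‖s - t‖ ∧
        wt L η j * ‖covDeriv η U₀ μ (gpar (lamOf s) - gpar (lamOf t)) x‖ ≤ ℓ₁ * ‖s - t‖)
    (hE0 : ∀ s : lamSubK η U₀ L k Eb, ‖s‖ ≤ α₄ / 4 → Bd2 L η k Ω (Eterm (lamOf s)) mE)
    (hEL : ∀ s t : lamSubK η U₀ L k Eb, ‖s‖ ≤ α₄ / 4 → ‖t‖ ≤ α₄ / 4 → Bd2 L η k Ω (Eterm (lamOf s) - Eterm (lamOf t)) (KE * ‖s - t‖))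
    (hDA : Bd2 L η k Ω DA cDA)
    (hA : ∀ j, j ≤ k → ∀ x ∈ Ω j, ∀ μ : Fin d,
      wt L η j * ‖A x μ‖ ≤ cA ∧ wt L η j * ‖conjR (U₀ (x - e μ) μ)⁻¹ (A (x - e μ) μ)‖ ≤ cA)
    (h103 : BG * Mc d BR b₁ cA mE cDA ≤ α₄ / 4) (h106 : BG * Kc d BR b₁ cA mE cDA KE ℓ₀ ℓ₁ ≤ 1 / 2) :
    ∃! s : lamSubK η U₀ L k Eb, ‖s‖ ≤ α₄ / 4 ∧ lamOf s = Gp (PsiP5 η U₀ A DA R gpar Eterm (lamOf s)) := by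
  set mW := mWc d b₁ cA mE cDA with hmWdef
  have hmW : 0 ≤ mW := mWc_nonneg hb₁.le hcA hmE hcDA
  have hcV : 0 ≤ 10 * a₁ := by positivity
  have ha12 : a₁ ≤ 1 / 12 := by linarith
  have hb70 : b₁ ≤ 1 / 70 := by linarith
  have hcA12 : cA ≤ 1 / 12 := by linarith
  -- the data (W_s, V_s) of a point of the ball satisfy the standing hypotheses of §2
  have hVsub : ∀ s : lamSubK η U₀ L k Eb, ‖s‖ ≤ α₄ / 4 → ∀ f g : Site d → 𝔸, ∀ j, j ≤ k → ∀ x ∈ Ω j,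
      Vop (gpar (lamOf s)) f x - Vop (gpar (lamOf s)) g x = Vop (gpar (lamOf s)) (f - g) x :=
    fun s hs f g j hj x hx => Vop_sub f g ((hg0 s hs j hj x hx).trans ha12)
  have hVbd : ∀ s : lamSubK η U₀ L k Eb, ‖s‖ ≤ α₄ / 4 → ∀ f : Site d → 𝔸, ∀ j, j ≤ k → ∀ x ∈ Ω j,
      ‖Vop (gpar (lamOf s)) f x‖ ≤ 10 * a₁ * ‖f x‖ :=
    fun s hs f j hj x hx => norm_Vop_le f (hg0 s hs j hj x hx) ha12
  have hW : ∀ s : lamSubK η U₀ L k Eb, ‖s‖ ≤ α₄ / 4 → Bd2 L η k Ω (Wsrc η U₀ A DA (gpar (lamOf s)) (Eterm (lamOf s))) mW :=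
    fun s hs j hj x hx => wt_sq_norm_Wsrc_le hL hη hb70 hcA hcA12 ((hg0 s hs j hj x hx).trans ha12) (hg1 s hs j hj x hx) (hA j hj x hx)
      (hE0 s hs j hj x hx) (hDA j hj x hx)
  -- (1.98)R + (1.99): the size of Ψ on the ball
  have hΨ0 : ∀ s : lamSubK η U₀ L k Eb, ‖s‖ ≤ α₄ / 4 → ∀ j, j ≤ k → ∀ x ∈ Ω j,
      wt L η j ^ 2 * ‖PsiP5 η U₀ A DA R gpar Eterm (lamOf s) x‖ ≤ Mc d BR b₁ cA mE cDA := by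
    intro s hs
    have hZ := bd2_zsol hL hη (hVsub s hs) (hVbd s hs) hRsub hRbd (hW s hs) hcV hBR hmW hθ
    exact hRbd _ _ (by positivity) hZ.neg
  -- (1.106): the Lipschitz modulus of Ψ on the ball
  have hΨ1 : ∀ s t : lamSubK η U₀ L k Eb, ‖s‖ ≤ α₄ / 4 → ‖t‖ ≤ α₄ / 4 → ∀ j, j ≤ k → ∀ x ∈ Ω j,
      wt L η j ^ 2 * ‖PsiP5 η U₀ A DA R gpar Eterm (lamOf s) x - PsiP5 η U₀ A DA R gpar Eterm (lamOf t) x‖ ≤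
        Kc d BR b₁ cA mE cDA KE ℓ₀ ℓ₁ * ‖s - t‖ := by
    intro s t hs ht
    have hδ : 0 ≤ ‖s - t‖ := norm_nonneg _
    have hKW : 0 ≤ KWc d b₁ cA mE cDA KE ℓ₀ ℓ₁ := KWc_nonneg hb₁.le hcA hmE hcDA hKE hℓ₀ hℓ₁
    -- moduli of the data
    have hdW : Bd2 L η k Ω (Wsrc η U₀ A DA (gpar (lamOf s)) (Eterm (lamOf s)) - Wsrc η U₀ A DA (gpar (lamOf t)) (Eterm (lamOf t)))
        (KWc d b₁ cA mE cDA KE ℓ₀ ℓ₁ * ‖s - t‖) := by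
      intro j hj x hx
      have h := wt_sq_norm_Wsrc_sub_le (U₀ := U₀) (A := A) (DA := DA) hL hη hb₁ hb₁' hcA hcA' (by positivity : 0 ≤ ℓ₀ * ‖s - t‖)
        ((hg0 s hs j hj x hx).trans ha₁') ((hg0 t ht j hj x hx).trans ha₁') (hg1 s hs j hj x hx) (hg1 t ht j hj x hx) (hA j hj x hx)
        (hE0 t ht j hj x hx) (hDA j hj x hx) (hgL s t hs ht j hj x hx).1 (fun μ => (hgL s t hs ht j hj x hx).2 μ)
        (by simpa only [Pi.sub_apply] using hEL s t hs ht j hj x hx)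
      rw [Pi.sub_apply]
      refine h.trans (le_of_eq ?_)
      unfold KWc; ring
    have hdV : ∀ g : Site d → 𝔸, ∀ j, j ≤ k → ∀ x ∈ Ω j,
        ‖Vop (gpar (lamOf s)) g x - Vop (gpar (lamOf t)) g x‖ ≤ 10 * ℓ₀ * ‖s - t‖ * ‖g x‖ := by
      intro g j hj x hx
      have h := norm_Vop_sub_Vop_le g ((hg0 s hs j hj x hx).trans ha12) ((hg0 t ht j hj x hx).trans ha12)
      calc ‖Vop (gpar (lamOf s)) g x - Vop (gpar (lamOf t)) g x‖ ≤ 10 * ‖g x‖ * ‖gpar (lamOf s) x - gpar (lamOf t) x‖ := h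
        _ ≤ 10 * ‖g x‖ * (ℓ₀ * ‖s - t‖) := by gcongr; exact (hgL s t hs ht j hj x hx).1
        _ = 10 * ℓ₀ * ‖s - t‖ * ‖g x‖ := by ring
    have hZZ := bd2_zsol_sub_zsol hL hη (hVsub s hs) (hVbd s hs) (hVsub t ht) (hVbd t ht) hRsub hRbd (hW s hs) (hW t ht) hcV hBR hmW hθ
      (mul_nonneg hKW hδ) (by positivity : 0 ≤ 10 * ℓ₀ * ‖s - t‖) hdW hdV
    -- Ψ s − Ψ t = R(−(Z_s − Z_t))
    have h2c : 0 ≤ 2 * (KWc d b₁ cA mE cDA KE ℓ₀ ℓ₁ * ‖s - t‖ + 10 * ℓ₀ * ‖s - t‖ * (BR * (2 * mW))) := by positivity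
    have hneg := (hRbd _ _ h2c hZZ.neg)
    intro j hj x hx
    have h := hneg j hj x hx
    have heq : PsiP5 η U₀ A DA R gpar Eterm (lamOf s) x - PsiP5 η U₀ A DA R gpar Eterm (lamOf t) x =
        R (-(Zsol (Wsrc η U₀ A DA (gpar (lamOf s)) (Eterm (lamOf s))) (Vop (gpar (lamOf s))) R -
          Zsol (Wsrc η U₀ A DA (gpar (lamOf t)) (Eterm (lamOf t))) (Vop (gpar (lamOf t))) R)) x := by
      simp only [PsiP5]
      rw [← Pi.sub_apply (R _) (R _), ← hRsub]
      congr 1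
      funext y; simp only [Pi.sub_apply, Pi.neg_apply]; abel
    rw [heq]
    refine h.trans (le_of_eq ?_)
    unfold Kc; ring
  have hKW : 0 ≤ KWc d b₁ cA mE cDA KE ℓ₀ ℓ₁ := KWc_nonneg hb₁.le hcA hmE hcDA hKE hℓ₀ hℓ₁
  have hM0 : 0 ≤ Mc d BR b₁ cA mE cDA := by unfold Mc; positivity
  have hK0 : 0 ≤ Kc d BR b₁ cA mE cDA KE ℓ₀ ℓ₁ := by unfold Kc; positivity
  exact fixedPoint_kLevel hη.le Ω Gp (PsiP5 η U₀ A DA R gpar Eterm) hα₄ hBG hM0 hK0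
    (fun f m hm hf => hG f m hm hf) hGsub hΨ0 hΨ1 h103 h106

/-- **WHAT THE FIXED POINT CARRIES** (for №41-a's steps (ii)–(iii)): for any `s` in the ball with `λ_s = G′(Ψ λ_s)` under the standing
hypotheses — (a) the NEUMANN IDENTITY `Z + V_{λ′}(RZ) = W` on every `Ω_j` (so that (1.88) + `R² = R` give `R(D*A′) = 0`); (b) the size
`|Z|₍₋₂₎ ≤ 2m_W`; (c) the bound `‖s‖ ≤ B_G·M` ((1.108)'s source: `norm_le_iff` turns it into `|λ| ≤ B_GM`, `(Lʲη)|Dλ| ≤ B_GM`); (d) `λ_s = 0` off `Ω₀`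
when G′ has the Dirichlet range (`hGsupp`, [4] (3.24) «↾Ω₀»). [cite: Balaban1985RegularSpaces, (1.95)–(1.96) p.92, (1.108) p.94; Balaban1985BackgroundPropagators, (3.24) p.394] -/
theorem propFive_fixedPoint_kLevel_spec (hL : 1 ≤ L) (hη : 0 < η)
    (Gp R gpar Eterm : (Site d → 𝔸) → (Site d → 𝔸))
    {α₄ BG BR a₁ b₁ cA cDA mE : ℝ}
    (hBR : 0 ≤ BR) (ha₁ : 0 ≤ a₁) (ha₁' : a₁ ≤ 1 / 24) (hb₁ : 0 < b₁) (hb₁' : b₁ ≤ 1 / 140)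
    (hcA : 0 ≤ cA) (hcA' : cA ≤ 1 / 13) (hcDA : 0 ≤ cDA) (hmE : 0 ≤ mE) (hθ : 10 * a₁ * BR ≤ 1 / 2)
    (hG : ∀ (f : Site d → 𝔸) (m : ℝ), 0 ≤ m → Bd2 L η k Ω f m →
      (∀ x, ‖Gp f x‖ ≤ BG * m) ∧ ∀ j, j ≤ k → ∀ p ∈ Eb j, wt L η j * ‖covDerivFwd η U₀ p.2 (Gp f) p.1‖ ≤ BG * m)
    (hGsupp : ∀ (f : Site d → 𝔸) (x : Site d), x ∉ Ω 0 → Gp f x = 0)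
    (hRsub : ∀ f g : Site d → 𝔸, R (f - g) = R f - R g)
    (hRbd : ∀ (f : Site d → 𝔸) (m : ℝ), 0 ≤ m → Bd2 L η k Ω f m → Bd2 L η k Ω (R f) (BR * m))
    (hg0 : ∀ s : lamSubK η U₀ L k Eb, ‖s‖ ≤ α₄ / 4 → ∀ j, j ≤ k → ∀ x ∈ Ω j, ‖gpar (lamOf s) x‖ ≤ a₁)
    (hg1 : ∀ s : lamSubK η U₀ L k Eb, ‖s‖ ≤ α₄ / 4 → ∀ j, j ≤ k → ∀ x ∈ Ω j, ∀ μ : Fin d,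
      wt L η j * ‖covDerivFwd η U₀ μ (gpar (lamOf s)) x‖ ≤ b₁ ∧ wt L η j * ‖covDeriv η U₀ μ (gpar (lamOf s)) x‖ ≤ b₁)
    (hE0 : ∀ s : lamSubK η U₀ L k Eb, ‖s‖ ≤ α₄ / 4 → Bd2 L η k Ω (Eterm (lamOf s)) mE)
    (hDA : Bd2 L η k Ω DA cDA)
    (hA : ∀ j, j ≤ k → ∀ x ∈ Ω j, ∀ μ : Fin d,
      wt L η j * ‖A x μ‖ ≤ cA ∧ wt L η j * ‖conjR (U₀ (x - e μ) μ)⁻¹ (A (x - e μ) μ)‖ ≤ cA)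
    {s : lamSubK η U₀ L k Eb} (hs : ‖s‖ ≤ α₄ / 4) (hfix : lamOf s = Gp (PsiP5 η U₀ A DA R gpar Eterm (lamOf s))) :
    (∀ j, j ≤ k → ∀ x ∈ Ω j,
      Zsol (Wsrc η U₀ A DA (gpar (lamOf s)) (Eterm (lamOf s))) (Vop (gpar (lamOf s))) R x +
        Vop (gpar (lamOf s)) (R (Zsol (Wsrc η U₀ A DA (gpar (lamOf s)) (Eterm (lamOf s))) (Vop (gpar (lamOf s))) R)) x =
      Wsrc η U₀ A DA (gpar (lamOf s)) (Eterm (lamOf s)) x) ∧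
    Bd2 L η k Ω (Zsol (Wsrc η U₀ A DA (gpar (lamOf s)) (Eterm (lamOf s))) (Vop (gpar (lamOf s))) R) (2 * mWc d b₁ cA mE cDA) ∧
    ‖s‖ ≤ BG * Mc d BR b₁ cA mE cDA ∧
    (∀ x, x ∉ Ω 0 → lamOf s x = 0) := by
  set mW := mWc d b₁ cA mE cDA with hmWdef
  have hmW : 0 ≤ mW := mWc_nonneg hb₁.le hcA hmE hcDA
  have hcV : 0 ≤ 10 * a₁ := by positivity
  have ha12 : a₁ ≤ 1 / 12 := by linarith
  have hb70 : b₁ ≤ 1 / 70 := by linarith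
  have hcA12 : cA ≤ 1 / 12 := by linarith
  have hVsub : ∀ f g : Site d → 𝔸, ∀ j, j ≤ k → ∀ x ∈ Ω j,
      Vop (gpar (lamOf s)) f x - Vop (gpar (lamOf s)) g x = Vop (gpar (lamOf s)) (f - g) x :=
    fun f g j hj x hx => Vop_sub f g ((hg0 s hs j hj x hx).trans ha12)
  have hVbd : ∀ f : Site d → 𝔸, ∀ j, j ≤ k → ∀ x ∈ Ω j, ‖Vop (gpar (lamOf s)) f x‖ ≤ 10 * a₁ * ‖f x‖ :=
    fun f j hj x hx => norm_Vop_le f (hg0 s hs j hj x hx) ha12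
  have hW : Bd2 L η k Ω (Wsrc η U₀ A DA (gpar (lamOf s)) (Eterm (lamOf s))) mW :=
    fun j hj x hx => wt_sq_norm_Wsrc_le hL hη hb70 hcA hcA12 ((hg0 s hs j hj x hx).trans ha12) (hg1 s hs j hj x hx) (hA j hj x hx)
      (hE0 s hs j hj x hx) (hDA j hj x hx)
  have hZ := bd2_zsol hL hη hVsub hVbd hRsub hRbd hW hcV hBR hmW hθ
  refine ⟨fun j hj x hx => zsol_eq hL hη hVsub hVbd hRsub hRbd hW hcV hBR hmW hθ hj hx, hZ, ?_, ?_⟩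
  · -- ‖s‖ ≤ B_G·M from the fixed-point equation and the letter bound
    have hΨ : Bd2 L η k Ω (PsiP5 η U₀ A DA R gpar Eterm (lamOf s)) (Mc d BR b₁ cA mE cDA) :=
      hRbd _ _ (by positivity) hZ.neg
    have hB : 0 ≤ BG * Mc d BR b₁ cA mE cDA := by
      obtain ⟨h0, -⟩ := hG _ _ (by unfold Mc; positivity) hΨ
      exact (norm_nonneg _).trans (h0 0)
    refine (norm_le_iff hη.le s hB).2 ⟨fun x => ?_, fun j hj p hp => ?_⟩
    · rw [hfix]; exact (hG _ _ (by unfold Mc; positivity) hΨ).1 x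
    · rw [hfix]; exact (hG _ _ (by unfold Mc; positivity) hΨ).2 j hj p hp
  · intro x hx
    rw [hfix]; exact hGsupp _ x hx

end Assembly

#print axioms zsol_eq
#print axioms propFive_fixedPoint_kLevel
#print axioms propFive_fixedPoint_kLevel_spec
#print axioms bd2_zsol_sub_zsol

end Literature.MathematicalPhysics.QuantumFieldTheory.Balaban1983to89.B8Prop5ContractionKLevel

end
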